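import Literature.Computability.Complexity.StackNegacyclic
import Literature.Computability.Complexity.StackIntsMul
import HarnessLib

/-!
# One level of the negacyclic FFT on stack registers: pair operations, segments, the level pass

Literature / complexity toolkit, continuing `StackZnVectors.lean` (vector passes `vAddMod`,
`vSubMod`, `vScaleMod`, `vNegShift`) and `StackNegacyclic.lean` (roles `NReg`, the
schoolbook multiplier).  Fourth layer of the polynomial-arithmetic programme serving the machine
of Harvey's deterministic factoring algorithm (`Cryptography/PQCWave0.lean`, fact
`harvey_factoring_one_fifth`): the machine form of ONE LEVEL of the Cantor–Kaltofen /
Schönhage–Strassen transform of `NegacyclicFFTAlgebra.lean` — a single streaming pass over a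
flat batch of blocks driven by a list of twiddle exponents.

* Data: a list of blocks is coded as items, `encBlocks Bs = encList (Bs.map encVec)`
  (`readItemTo` delivers a block straight into a vector-pass input register, `emit` re-items a
  result: `pushItem`, `pushAll`, `pushBlocks`, `outRev_append_list`, `reverse_encBlocks`);
  roles `FReg` (the multiplier roles `n x`, plus `IN HOLD HOLD2 TMP TW TWACC T1 CNT X1 X2 OACC
  SACC M2 M4 HN OUT TWOUT`), the record `FSlots` / `fSt` of the sixteen registers a pass
  rewrites (read / write `simp` lemmas), the invariant `LvlInv` (modulus `N`, block length
  `2m`, constants `2m`, `4m`, vector-pass constant `cw`, clean scratch);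
* pair operations: `pairFwd` (**`runs_pairFwd`**: emit `u + x^E w` onto `OACC` and `u − x^E w`
  onto `SACC`) and `pairInv` (**`runs_pairInv`**: `(u + w)·2⁻¹` and `x^{4m−E}(u − w)·2⁻¹`),
  abstractly `PairOp` (`pairOp_pairFwd`, `pairOp_pairInv`), and the zip loop of a segment
  **`runs_pairLoop`**; the block-move loop `moveBlock` / **`runs_moveBlocks`**;
* a segment = `segTwiddle` (read `F = 2E` from `TW`, `E := F/2` by dropping the low bit, emit the
  children `E`, `E + 2m`) ;; `segSplit` (first `h` blocks onto `HOLD`, poured as a list onto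
  `HOLD2`) ;; `segZip` (the zip loop, second halves transferred `SACC → TMP → OACC`, `E`
  cleared): **`runs_segBody`**;
* the level pass `levelPass pairC` = segment loop over `TW`, then pours onto `OUT`, `TWOUT`:
  **`runs_levelPass`** — with twiddles `Fs` and `2h·|Fs|` valid blocks `Bs` it puts
  `encBlocks (levelOut g₁ g₂ h Fs Bs)` on `OUT` and `encVec (childTw m Fs)` on `TWOUT` within
  `levelCost cP n m h |Fs|` (linear in the data size times `(n+1)³`); `levelOut` / `childTw` are
  the list-level effects (`levelOut_append`, `length_levelOut`, `levelOut_valid`), to be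
  identified with one level of `fwdN` / `invN` of `NegacyclicFFT.lean` by the recursion driver.

## References

* J. von zur Gathen, J. Gerhard, *Modern Computer Algebra*, 3rd ed., CUP 2013, §8.2 (the
  butterfly network, Fig. 8.4–8.5), §8.3 Alg. 8.20 (Schönhage–Strassen). (Folklore material,
  fully proved here.)
* D. G. Cantor, E. Kaltofen, Acta Inform. 28 (1991) 693–701 (the residue form of the transform).
* D. Harvey, Math. Comp. 90 (2021), §2.2 (the cost model `M_N(d)`) [Harvey2021].
* T. Nipkow, G. Klein, *Concrete Semantics with Isabelle/HOL*, Springer 2014, §7.2 — the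
  verification style of `StackPrograms.lean`.
-/

namespace Literature.Computability.Complexity

open _root_.Computability SProg

/-! ### Register roles of the level passes -/

/-- Roles of the FFT level passes: the schoolbook-multiplier roles `n x` (hence the vector-pass
roles `n (v x)`), the block list `IN`, the item buffers `HOLD`, `HOLD2`, `TMP`, the twiddle
list `TW` and the accumulator of the children twiddles `TWACC`, numeral scratch `T1`, the unary
segment counter `CNT`, block buffers `X1`, `X2`, the output accumulators `OACC` (whole pass) and
`SACC` (second halves of the current segment), the constants `M2 = 2m`, `M4 = 4m`, the half
segment length `HN`, the forward output `OUT` and the twiddle output `TWOUT`. [folklore] -/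
inductive FReg where
  | n (x : NReg)
  | IN | HOLD | HOLD2 | TMP | TW | TWACC | T1 | CNT | X1 | X2 | OACC | SACC | M2 | M4 | HN | OUT | TWOUT
  deriving DecidableEq

/-- The multiplier roles inside the level-pass roles. [folklore] -/
def FReg.ιN : NReg ↪ FReg := ⟨FReg.n, fun _ _ h => FReg.n.inj h⟩

/-- `ιN` is the constructor `n`. [folklore] -/
@[simp] theorem FReg.ιN_apply (x : NReg) : FReg.ιN x = FReg.n x := rfl

namespace Com

variable {β : Type} [DecidableEq β] (q : FReg ↪ β)

/-- The multiplier roles in the outer bank. [folklore] -/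
abbrev rN : NReg ↪ β := FReg.ιN.trans q

/-- The vector-pass roles in the outer bank. [folklore] -/
abbrev rVF : VReg ↪ β := (NReg.ιV.trans FReg.ιN).trans q

/-! ### The working registers of the level passes as a record -/

/-- Contents of the registers a level pass rewrites. [folklore] -/
structure FSlots where
  /-- register `IN` -/ (inp : List Bool)
  /-- register `HOLD` -/ (hold : List Bool)
  /-- register `HOLD2` -/ (hold2 : List Bool)
  /-- register `TMP` -/ (tmp : List Bool)
  /-- register `TW` -/ (tw : List Bool)
  /-- register `TWACC` -/ (twacc : List Bool)
  /-- register `T1` -/ (t1 : List Bool)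
  /-- register `CNT` -/ (cnt : List Bool)
  /-- register `X1` -/ (x1 : List Bool)
  /-- register `X2` -/ (x2 : List Bool)
  /-- register `OACC` -/ (oacc : List Bool)
  /-- register `SACC` -/ (sacc : List Bool)
  /-- register `E` -/ (e : List Bool)
  /-- register `L1` -/ (l1 : List Bool)
  /-- register `L2` -/ (l2 : List Bool)
  /-- register `DST` -/ (dst : List Bool)

/-- The register file with the working registers set from a record. [folklore] -/
def fSt (T : Regs β) (z : FSlots) : Regs β :=
  Function.update (Function.update (Function.update (Function.update (Function.update (Function.update (Function.update (Function.update (Function.update (Function.update (Function.update (Function.update (Function.update (Function.update (Function.update (Function.update (T) (q .IN) z.inp) (q .HOLD) z.hold) (q .HOLD2) z.hold2) (q .TMP) z.tmp) (q .TW) z.tw) (q .TWACC) z.twacc) (q .T1) z.t1) (q .CNT) z.cnt) (q .X1) z.x1) (q .X2) z.x2) (q .OACC) z.oacc) (q .SACC) z.sacc) (q (.n (.v .E))) z.e) (q (.n (.v .L1))) z.l1) (q (.n (.v .L2))) z.l2) (q (.n (.v .DST))) z.dst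

section FStLemmas

variable (T : Regs β) (z : FSlots) (w : List Bool)

/-- Reading `IN`. [folklore] -/
@[simp] theorem fSt_IN : fSt q T z (q .IN) = z.inp := by simp [fSt]
/-- Reading `HOLD`. [folklore] -/
@[simp] theorem fSt_HOLD : fSt q T z (q .HOLD) = z.hold := by simp [fSt]
/-- Reading `HOLD2`. [folklore] -/
@[simp] theorem fSt_HOLD2 : fSt q T z (q .HOLD2) = z.hold2 := by simp [fSt]
/-- Reading `TMP`. [folklore] -/
@[simp] theorem fSt_TMP : fSt q T z (q .TMP) = z.tmp := by simp [fSt]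
/-- Reading `TW`. [folklore] -/
@[simp] theorem fSt_TW : fSt q T z (q .TW) = z.tw := by simp [fSt]
/-- Reading `TWACC`. [folklore] -/
@[simp] theorem fSt_TWACC : fSt q T z (q .TWACC) = z.twacc := by simp [fSt]
/-- Reading `T1`. [folklore] -/
@[simp] theorem fSt_T1 : fSt q T z (q .T1) = z.t1 := by simp [fSt]
/-- Reading `CNT`. [folklore] -/
@[simp] theorem fSt_CNT : fSt q T z (q .CNT) = z.cnt := by simp [fSt]
/-- Reading `X1`. [folklore] -/
@[simp] theorem fSt_X1 : fSt q T z (q .X1) = z.x1 := by simp [fSt]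
/-- Reading `X2`. [folklore] -/
@[simp] theorem fSt_X2 : fSt q T z (q .X2) = z.x2 := by simp [fSt]
/-- Reading `OACC`. [folklore] -/
@[simp] theorem fSt_OACC : fSt q T z (q .OACC) = z.oacc := by simp [fSt]
/-- Reading `SACC`. [folklore] -/
@[simp] theorem fSt_SACC : fSt q T z (q .SACC) = z.sacc := by simp [fSt]
/-- Reading `E`. [folklore] -/
@[simp] theorem fSt_E : fSt q T z (q (.n (.v .E))) = z.e := by simp [fSt]
/-- Reading `L1`. [folklore] -/
@[simp] theorem fSt_L1 : fSt q T z (q (.n (.v .L1))) = z.l1 := by simp [fSt]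
/-- Reading `L2`. [folklore] -/
@[simp] theorem fSt_L2 : fSt q T z (q (.n (.v .L2))) = z.l2 := by simp [fSt]
/-- Reading `DST`. [folklore] -/
@[simp] theorem fSt_DST : fSt q T z (q (.n (.v .DST))) = z.dst := by simp [fSt]
/-- Reading an untouched vector-pass role. [folklore] -/
theorem fSt_v {x : VReg} (hE : x ≠ .E) (hL1 : x ≠ .L1) (hL2 : x ≠ .L2) (hDST : x ≠ .DST) :
    fSt q T z (q (.n (.v x))) = T (q (.n (.v x))) := by simp [fSt, hE, hL1, hL2, hDST]
/-- Reading an untouched multiplier role. [folklore] -/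
theorem fSt_nFP : fSt q T z (q (.n .FP)) = T (q (.n .FP)) := by simp [fSt]
/-- Reading `GP` (untouched). [folklore] -/
theorem fSt_nGP : fSt q T z (q (.n .GP)) = T (q (.n .GP)) := by simp [fSt]
/-- Reading `ACC` (untouched). [folklore] -/
theorem fSt_nACC : fSt q T z (q (.n .ACC)) = T (q (.n .ACC)) := by simp [fSt]
/-- Reading `M2` (untouched). [folklore] -/
@[simp] theorem fSt_M2 : fSt q T z (q .M2) = T (q .M2) := by simp [fSt]
/-- Reading `M4` (untouched). [folklore] -/
@[simp] theorem fSt_M4 : fSt q T z (q .M4) = T (q .M4) := by simp [fSt]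
/-- Reading `HN` (untouched). [folklore] -/
@[simp] theorem fSt_HN : fSt q T z (q .HN) = T (q .HN) := by simp [fSt]
/-- Reading `OUT` (untouched). [folklore] -/
@[simp] theorem fSt_OUT : fSt q T z (q .OUT) = T (q .OUT) := by simp [fSt]
/-- Reading `TWOUT` (untouched). [folklore] -/
@[simp] theorem fSt_TWOUT : fSt q T z (q .TWOUT) = T (q .TWOUT) := by simp [fSt]

/-- Writing `IN`. [folklore] -/
@[simp] theorem update_fSt_IN : Function.update (fSt q T z) (q .IN) w = fSt q T { z with inp := w } := by
  refine Regs.eq_of_on [(q .IN)] (by simp) fun k hk => ?_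
  simp only [List.mem_singleton] at hk
  simp only [fSt, Function.update_apply, hk, if_false]
/-- Writing `HOLD`. [folklore] -/
@[simp] theorem update_fSt_HOLD : Function.update (fSt q T z) (q .HOLD) w = fSt q T { z with hold := w } := by
  refine Regs.eq_of_on [(q .HOLD)] (by simp) fun k hk => ?_
  simp only [List.mem_singleton] at hk
  simp only [fSt, Function.update_apply, hk, if_false]
/-- Writing `HOLD2`. [folklore] -/
@[simp] theorem update_fSt_HOLD2 : Function.update (fSt q T z) (q .HOLD2) w = fSt q T { z with hold2 := w } := by
  refine Regs.eq_of_on [(q .HOLD2)] (by simp) fun k hk => ?_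
  simp only [List.mem_singleton] at hk
  simp only [fSt, Function.update_apply, hk, if_false]
/-- Writing `TMP`. [folklore] -/
@[simp] theorem update_fSt_TMP : Function.update (fSt q T z) (q .TMP) w = fSt q T { z with tmp := w } := by
  refine Regs.eq_of_on [(q .TMP)] (by simp) fun k hk => ?_
  simp only [List.mem_singleton] at hk
  simp only [fSt, Function.update_apply, hk, if_false]
/-- Writing `TW`. [folklore] -/
@[simp] theorem update_fSt_TW : Function.update (fSt q T z) (q .TW) w = fSt q T { z with tw := w } := by
  refine Regs.eq_of_on [(q .TW)] (by simp) fun k hk => ?_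
  simp only [List.mem_singleton] at hk
  simp only [fSt, Function.update_apply, hk, if_false]
/-- Writing `TWACC`. [folklore] -/
@[simp] theorem update_fSt_TWACC : Function.update (fSt q T z) (q .TWACC) w = fSt q T { z with twacc := w } := by
  refine Regs.eq_of_on [(q .TWACC)] (by simp) fun k hk => ?_
  simp only [List.mem_singleton] at hk
  simp only [fSt, Function.update_apply, hk, if_false]
/-- Writing `T1`. [folklore] -/
@[simp] theorem update_fSt_T1 : Function.update (fSt q T z) (q .T1) w = fSt q T { z with t1 := w } := by
  refine Regs.eq_of_on [(q .T1)] (by simp) fun k hk => ?_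
  simp only [List.mem_singleton] at hk
  simp only [fSt, Function.update_apply, hk, if_false]
/-- Writing `CNT`. [folklore] -/
@[simp] theorem update_fSt_CNT : Function.update (fSt q T z) (q .CNT) w = fSt q T { z with cnt := w } := by
  refine Regs.eq_of_on [(q .CNT)] (by simp) fun k hk => ?_
  simp only [List.mem_singleton] at hk
  simp only [fSt, Function.update_apply, hk, if_false]
/-- Writing `X1`. [folklore] -/
@[simp] theorem update_fSt_X1 : Function.update (fSt q T z) (q .X1) w = fSt q T { z with x1 := w } := by
  refine Regs.eq_of_on [(q .X1)] (by simp) fun k hk => ?_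
  simp only [List.mem_singleton] at hk
  simp only [fSt, Function.update_apply, hk, if_false]
/-- Writing `X2`. [folklore] -/
@[simp] theorem update_fSt_X2 : Function.update (fSt q T z) (q .X2) w = fSt q T { z with x2 := w } := by
  refine Regs.eq_of_on [(q .X2)] (by simp) fun k hk => ?_
  simp only [List.mem_singleton] at hk
  simp only [fSt, Function.update_apply, hk, if_false]
/-- Writing `OACC`. [folklore] -/
@[simp] theorem update_fSt_OACC : Function.update (fSt q T z) (q .OACC) w = fSt q T { z with oacc := w } := by
  refine Regs.eq_of_on [(q .OACC)] (by simp) fun k hk => ?_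
  simp only [List.mem_singleton] at hk
  simp only [fSt, Function.update_apply, hk, if_false]
/-- Writing `SACC`. [folklore] -/
@[simp] theorem update_fSt_SACC : Function.update (fSt q T z) (q .SACC) w = fSt q T { z with sacc := w } := by
  refine Regs.eq_of_on [(q .SACC)] (by simp) fun k hk => ?_
  simp only [List.mem_singleton] at hk
  simp only [fSt, Function.update_apply, hk, if_false]
/-- Writing `E`. [folklore] -/
@[simp] theorem update_fSt_E : Function.update (fSt q T z) (q (.n (.v .E))) w = fSt q T { z with e := w } := by
  refine Regs.eq_of_on [(q (.n (.v .E)))] (by simp) fun k hk => ?_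
  simp only [List.mem_singleton] at hk
  simp only [fSt, Function.update_apply, hk, if_false]
/-- Writing `L1`. [folklore] -/
@[simp] theorem update_fSt_L1 : Function.update (fSt q T z) (q (.n (.v .L1))) w = fSt q T { z with l1 := w } := by
  refine Regs.eq_of_on [(q (.n (.v .L1)))] (by simp) fun k hk => ?_
  simp only [List.mem_singleton] at hk
  simp only [fSt, Function.update_apply, hk, if_false]
/-- Writing `L2`. [folklore] -/
@[simp] theorem update_fSt_L2 : Function.update (fSt q T z) (q (.n (.v .L2))) w = fSt q T { z with l2 := w } := by
  refine Regs.eq_of_on [(q (.n (.v .L2)))] (by simp) fun k hk => ?_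
  simp only [List.mem_singleton] at hk
  simp only [fSt, Function.update_apply, hk, if_false]
/-- Writing `DST`. [folklore] -/
@[simp] theorem update_fSt_DST : Function.update (fSt q T z) (q (.n (.v .DST))) w = fSt q T { z with dst := w } := by
  refine Regs.eq_of_on [(q (.n (.v .DST)))] (by simp) fun k hk => ?_
  simp only [List.mem_singleton] at hk
  simp only [fSt, Function.update_apply, hk, if_false]

end FStLemmas

/-! ### Lists of blocks as items -/

/-- The coding of a list of blocks as items (each item's payload the block's `encVec`).
[folklore] -/
def _root_.Literature.Computability.Complexity.encBlocks (Bs : List (List ℕ)) : List Bool :=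
  encList (Bs.map encVec)

/-- Coding of no blocks. [folklore] -/
@[simp] theorem _root_.Literature.Computability.Complexity.encBlocks_nil : encBlocks [] = [] := rfl

/-- Coding of a nonempty list of blocks. [folklore] -/
theorem _root_.Literature.Computability.Complexity.encBlocks_cons (b : List ℕ) (Bs : List (List ℕ)) :
    encBlocks (b :: Bs) = dbl (encVec b) ++ false :: true :: encBlocks Bs := by
  unfold encBlocks; rw [List.map_cons, encList_cons_eq_dbl]

/-- Pushing the item of a block onto a reversed accumulator (the effect of `emit`). [folklore] -/
def _root_.Literature.Computability.Complexity.pushItem (b : List ℕ) (acc : List Bool) : List Bool :=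
  true :: false :: ((dbl (encVec b)).reverse ++ acc)

/-- The reversed accumulator of a list of emitted blocks. [folklore] -/
theorem _root_.Literature.Computability.Complexity.outRev_map_encVec_append (Bs : List (List ℕ)) (b : List ℕ) :
    outRev ((Bs ++ [b]).map encVec) = pushItem b (outRev (Bs.map encVec)) := by
  rw [List.map_append, List.map_singleton, outRev_append]; rfl

/-- Length of the code of a valid block. [folklore] -/
theorem length_encVec_block {N n L : ℕ} {u : List ℕ} (hu : u.length = L ∧ ∀ a ∈ u, a < N)
    (hn : (encodeNat N).length + 1 ≤ n) : (encVec u).length ≤ L * (2 * n) :=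
  (length_encVec_le_of_lt hu.2 hn).trans (by rw [hu.1])

/-! ### The invariant of the level passes -/

/-- The clean-scratch condition of the level passes: modulus `N`, block length `2m`, the
constants `2m`, `4m` and the vector-pass constant `cw` in place, all vector-pass scratch empty.
[folklore] -/
def LvlInv (N m : ℕ) (cw : List Bool) (T : Regs β) : Prop :=
  T (q (.n (.v .MD))) = encodeNat N ∧ T (q (.n (.v .LEN))) = encodeNat (2 * m) ∧ T (q (.n (.v .C))) = cw ∧
  T (q .M2) = encodeNat (2 * m) ∧ T (q .M4) = encodeNat (4 * m) ∧
  T (q (.n (.v .A))) = [] ∧ T (q (.n (.v .B))) = [] ∧ T (q (.n (.v .D))) = [] ∧ T (q (.n (.v .F))) = [] ∧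
  T (q (.n (.v .G))) = [] ∧ T (q (.n (.v .W))) = [] ∧ T (q (.n (.v .TT))) = [] ∧ T (q (.n (.v .O))) = [] ∧
  T (q (.n (.v .S))) = [] ∧ T (q (.n (.v .U))) = []

/-! ### The forward pair operation -/

/-- The forward pair operation: with the next `w` of `IN` and the next `u` of `HOLD2`, emit
`u + x^E w` onto `OACC` and `u − x^E w` onto `SACC` (blocks of length `2m`, `E` in `E`).
[folklore] -/
def pairFwd : Com (EReg ⊕ β) :=
  readItemTo (Sum.inr (q .IN)) (vr (rVF q) .L1) (vr (rVF q) .W) (vr (rVF q) .TT) ;;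
  (vNegShift (rVF q) ;;
  (move (vr (rVF q) .DST) (Sum.inr (q .X1)) (ra .s) ;;
  (readItemTo (Sum.inr (q .HOLD2)) (Sum.inr (q .X2)) (vr (rVF q) .W) (vr (rVF q) .TT) ;;
  (copy (Sum.inr (q .X2)) (vr (rVF q) .L1) (ra .t) (ra .u) ;;
  (copy (Sum.inr (q .X1)) (vr (rVF q) .L2) (ra .t) (ra .u) ;;
  (vAddMod (rVF q) ;;
  (emit (vr (rVF q) .DST) (Sum.inr (q .OACC)) ;;
  (move (Sum.inr (q .X2)) (vr (rVF q) .L1) (ra .s) ;;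
  (move (Sum.inr (q .X1)) (vr (rVF q) .L2) (ra .s) ;;
  (vSubMod (rVF q) ;;
  emit (vr (rVF q) .DST) (Sum.inr (q .SACC))))))))))))

/-- Cost of a pair operation on blocks of length `2m`. [folklore] -/
def pairCost (n m : ℕ) : ℕ := (2 * m) * (2700 * (n + 1) ^ 3) + 300 * (n + 1) ^ 3

/-- **The forward pair operation.** [folklore] -/
theorem runs_pairFwd {N n m E : ℕ} {cw : List Bool} (hn : (encodeNat N).length + 1 ≤ n)
    (hmn : (encodeNat (2 * m)).length + 1 ≤ n) (hE : E < 4 * m) (T : Regs β) (hI : LvlInv q N m cw T)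
    (z : FSlots) {u w : List ℕ} {us ws : List (List ℕ)} (hu : u.length = 2 * m ∧ ∀ a ∈ u, a < N)
    (hw : w.length = 2 * m ∧ ∀ a ∈ w, a < N) (hzin : z.inp = encBlocks (w :: ws)) (hzh2 : z.hold2 = encBlocks (u :: us))
    (hze : z.e = encodeNat E) (hzl1 : z.l1 = []) (hzl2 : z.l2 = []) (hzd : z.dst = []) (hzx1 : z.x1 = []) (hzx2 : z.x2 = []) :
    Runs (pairFwd q) (base (fSt q T z))
      (base (fSt q T { z with inp := encBlocks ws, hold2 := encBlocks us, oacc := pushItem (vaddMod N u (negShift N (2 * m) E w)) z.oacc, sacc := pushItem (vsubMod N u (negShift N (2 * m) E w)) z.sacc }))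
      (pairCost n m) := by
  have hq : ∀ {i j : FReg}, i ≠ j → q i ≠ q j := fun h => q.injective.ne h
  obtain ⟨hMD, hLEN, hC, -, -, hA, hB, hD, hF, hG, hW, hTT, hO, hS, hU⟩ := hI
  -- reads of untouched registers through any record
  have rd : ∀ (z : FSlots) (x : VReg), x ≠ .E → x ≠ .L1 → x ≠ .L2 → x ≠ .DST →
      fSt q T z (q (.n (.v x))) = T (q (.n (.v x))) := fun z x h1 h2 h3 h4 => fSt_v q T z h1 h2 h3 h4
  have hN : 0 < N := by
    rcases u with _ | ⟨a, u'⟩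
    · simp at hu; omega
    · have := hu.2 a (by simp); omega
  set c := (n + 1) ^ 3 with hc3
  have hc : n + 1 ≤ c := succ_le_cube n
  -- the intermediate blocks
  set sh := negShift N (2 * m) E w with hsh
  set r1 := vaddMod N u sh with hr1
  set r2 := vsubMod N u sh with hr2
  have hshB : sh.length = 2 * m ∧ ∀ a ∈ sh, a < N := ⟨length_negShift hw.1, fun a ha => lt_of_mem_negShift hN hw.2 ha⟩
  have hr1B : r1.length = 2 * m ∧ ∀ a ∈ r1, a < N :=
    ⟨by rw [hr1, length_vaddMod, hu.1, hshB.1, min_self], fun a ha => lt_of_mem_vaddMod hN ha⟩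
  have hr2B : r2.length = 2 * m ∧ ∀ a ∈ r2, a < N :=
    ⟨by rw [hr2, length_vsubMod, hu.1, hshB.1, min_self], fun a ha => lt_of_mem_vsubMod hN ha⟩
  have hlw := length_encVec_block hw hn
  have hlu := length_encVec_block hu hn
  have hlsh := length_encVec_block hshB hn
  have hlr1 := length_encVec_block hr1B hn
  have hlr2 := length_encVec_block hr2B hn
  have hLc : 2 * m * (2 * n) ≤ 2 * (2 * m * c) :=
    calc 2 * m * (2 * n) = 2 * (2 * m * n) := by ring
      _ ≤ 2 * (2 * m * c) := Nat.mul_le_mul_left 2 (Nat.mul_le_mul_left _ (by omega))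
  -- records
  let z1 : FSlots := { z with inp := encBlocks ws, l1 := encVec w }
  let z2 : FSlots := { z with inp := encBlocks ws, l1 := [], dst := encVec sh }
  let z3 : FSlots := { z with inp := encBlocks ws, l1 := [], dst := [], x1 := encVec sh }
  let z4 : FSlots := { z with inp := encBlocks ws, l1 := [], dst := [], x1 := encVec sh, hold2 := encBlocks us, x2 := encVec u }
  let z5 : FSlots := { z with inp := encBlocks ws, l1 := encVec u, dst := [], x1 := encVec sh, hold2 := encBlocks us, x2 := encVec u }
  let z6 : FSlots := { z with inp := encBlocks ws, l1 := encVec u, l2 := encVec sh, dst := [], x1 := encVec sh, hold2 := encBlocks us, x2 := encVec u }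
  let z7 : FSlots := { z with inp := encBlocks ws, l1 := [], l2 := [], dst := encVec r1, x1 := encVec sh, hold2 := encBlocks us, x2 := encVec u }
  let z8 : FSlots := { z with inp := encBlocks ws, l1 := [], l2 := [], dst := [], x1 := encVec sh, hold2 := encBlocks us, x2 := encVec u, oacc := pushItem r1 z.oacc }
  let z9 : FSlots := { z with inp := encBlocks ws, l1 := encVec u, l2 := [], dst := [], x1 := encVec sh, hold2 := encBlocks us, x2 := [], oacc := pushItem r1 z.oacc }
  let z10 : FSlots := { z with inp := encBlocks ws, l1 := encVec u, l2 := encVec sh, dst := [], x1 := [], hold2 := encBlocks us, x2 := [], oacc := pushItem r1 z.oacc }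
  let z11 : FSlots := { z with inp := encBlocks ws, l1 := [], l2 := [], dst := encVec r2, x1 := [], hold2 := encBlocks us, x2 := [], oacc := pushItem r1 z.oacc }
  let z12 : FSlots := { z with inp := encBlocks ws, l1 := [], l2 := [], dst := [], x1 := [], hold2 := encBlocks us, x2 := [], oacc := pushItem r1 z.oacc, sacc := pushItem r2 z.sacc }
  -- 1. read `w`
  have h1 : Runs (readItemTo (Sum.inr (q .IN)) (vr (rVF q) .L1) (vr (rVF q) .W) (vr (rVF q) .TT)) (base (fSt q T z))
      (base (fSt q T z1)) (22 * (2 * m * c) + 9) := by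
    refine (runs_readItemTo (by simp [hq]) (by simp [hq]) (by simp [hq]) (by simp [hq]) (by simp [hq]) (encVec w) (encBlocks ws)
      (base (fSt q T z)) (by simp [hzin, encBlocks_cons]) (by simp [rd _ .W, hW]) (by simp [rd _ .TT, hTT])).of_eq
      (by simp [z1, hzl1]) ?_
    omega
  -- 2. shift
  have h2 : Runs (vNegShift (rVF q)) (base (fSt q T z1)) (base (fSt q T z2)) (vShiftCost n (2 * m)) := by
    have h := runs_vNegShift (rVF q) hn hmn (show E < 2 * (2 * m) by omega) (fSt q T z1) (u := w) hw.2 hw.1 (by simp [z1])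
      (by simp [rd _ .MD, hMD]) (by simp [z1, hze]) (by simp [rd _ .LEN, hLEN]) (by simp [rd _ .A, hA]) (by simp [rd _ .B, hB])
      (by simp [rd _ .D, hD]) (by simp [rd _ .F, hF]) (by simp [rd _ .G, hG]) (by simp [rd _ .W, hW]) (by simp [rd _ .TT, hTT])
      (by simp [rd _ .O, hO]) (by simp [rd _ .S, hS]) (by simp [rd _ .U, hU])
    exact h.of_eq (by simp [z1, z2, hzd, hsh]) le_rfl
  -- 3. move to X1
  have h3 : Runs (move (vr (rVF q) .DST) (Sum.inr (q .X1)) (ra .s)) (base (fSt q T z2)) (base (fSt q T z3)) (12 * (2 * m * c) + 2) := by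
    refine (runs_omove (a := rVF q .DST) (b := q .X1) (by simp [hq]) (fSt q T z2)).of_eq (by simp [z2, z3, hzx1]) ?_
    have : (fSt q T z2 (rVF q .DST)).length ≤ 2 * m * (2 * n) := by simp [z2, hlsh]
    omega
  -- 4. read `u`
  have h4 : Runs (readItemTo (Sum.inr (q .HOLD2)) (Sum.inr (q .X2)) (vr (rVF q) .W) (vr (rVF q) .TT)) (base (fSt q T z3))
      (base (fSt q T z4)) (22 * (2 * m * c) + 9) := by
    refine (runs_readItemTo (by simp [hq]) (by simp [hq]) (by simp [hq]) (by simp [hq]) (by simp [hq]) (encVec u) (encBlocks us)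
      (base (fSt q T z3)) (by simp [z3, hzh2, encBlocks_cons]) (by simp [rd _ .W, hW]) (by simp [rd _ .TT, hTT])).of_eq
      (by simp [z4, z3, hzx2]) ?_
    omega
  -- 5. copies
  have h5 : Runs (copy (Sum.inr (q .X2)) (vr (rVF q) .L1) (ra .t) (ra .u)) (base (fSt q T z4)) (base (fSt q T z5)) (20 * (2 * m * c) + 3) := by
    refine (runs_ocopy (a := q .X2) (b := rVF q .L1) (by simp [hq]) (fSt q T z4)).of_eq (by simp [z4, z5]) ?_
    have : (fSt q T z4 (q .X2)).length ≤ 2 * m * (2 * n) := by simp [z4, hlu]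
    omega
  have h6 : Runs (copy (Sum.inr (q .X1)) (vr (rVF q) .L2) (ra .t) (ra .u)) (base (fSt q T z5)) (base (fSt q T z6)) (20 * (2 * m * c) + 3) := by
    refine (runs_ocopy (a := q .X1) (b := rVF q .L2) (by simp [hq]) (fSt q T z5)).of_eq (by simp [z5, z6, hzl2]) ?_
    have : (fSt q T z5 (q .X1)).length ≤ 2 * m * (2 * n) := by simp [z5, hlsh]
    omega
  -- 7. add
  have h7 : Runs (vAddMod (rVF q)) (base (fSt q T z6)) (base (fSt q T z7)) (vArithCost n (2 * m)) := by
    have h := runs_vAddMod (rVF q) hn (fSt q T z6) (u := u) (v := sh) (by rw [hu.1, hshB.1]) hu.2 hshB.2 (by simp [z6])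
      (by simp [z6]) (by simp [rd _ .MD, hMD]) (by simp [rd _ .A, hA]) (by simp [rd _ .B, hB]) (by simp [rd _ .D, hD])
      (by simp [rd _ .F, hF]) (by simp [rd _ .W, hW]) (by simp [rd _ .TT, hTT]) (by simp [rd _ .O, hO])
    rw [hu.1] at h
    exact h.of_eq (by simp [z6, z7, hr1]) le_rfl
  -- 8. emit to OACC
  have h8 : Runs (emit (vr (rVF q) .DST) (Sum.inr (q .OACC))) (base (fSt q T z7)) (base (fSt q T z8)) (8 * (2 * m * c) + 3) := by
    refine (runs_emit (h := vr (rVF q) .DST) (o := Sum.inr (q .OACC)) (by simp [hq]) (base (fSt q T z7))).of_eq ?_ ?_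
    · simp [z7, z8, pushItem, dbl]
    · have : (fSt q T z7 (rVF q .DST)).length ≤ 2 * m * (2 * n) := by simp [z7, hlr1]
      change 4 * (fSt q T z7 (rVF q .DST)).length + 3 ≤ _
      omega
  -- 9. moves
  have h9 : Runs (move (Sum.inr (q .X2)) (vr (rVF q) .L1) (ra .s)) (base (fSt q T z8)) (base (fSt q T z9)) (12 * (2 * m * c) + 2) := by
    refine (runs_omove (a := q .X2) (b := rVF q .L1) (by simp [hq]) (fSt q T z8)).of_eq (by simp [z8, z9]) ?_
    have : (fSt q T z8 (q .X2)).length ≤ 2 * m * (2 * n) := by simp [z8, hlu]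
    omega
  have h10 : Runs (move (Sum.inr (q .X1)) (vr (rVF q) .L2) (ra .s)) (base (fSt q T z9)) (base (fSt q T z10)) (12 * (2 * m * c) + 2) := by
    refine (runs_omove (a := q .X1) (b := rVF q .L2) (by simp [hq]) (fSt q T z9)).of_eq (by simp [z9, z10]) ?_
    have : (fSt q T z9 (q .X1)).length ≤ 2 * m * (2 * n) := by simp [z9, hlsh]
    omega
  -- 11. subtract
  have h11 : Runs (vSubMod (rVF q)) (base (fSt q T z10)) (base (fSt q T z11)) (vArithCost n (2 * m)) := by
    have h := runs_vSubMod (rVF q) hn (fSt q T z10) (u := u) (v := sh) (by rw [hu.1, hshB.1]) hu.2 hshB.2 (by simp [z10])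
      (by simp [z10]) (by simp [rd _ .MD, hMD]) (by simp [rd _ .A, hA]) (by simp [rd _ .B, hB]) (by simp [rd _ .D, hD])
      (by simp [rd _ .F, hF]) (by simp [rd _ .W, hW]) (by simp [rd _ .TT, hTT]) (by simp [rd _ .O, hO])
    rw [hu.1] at h
    exact h.of_eq (by simp [z10, z11, hr2]) le_rfl
  -- 12. emit to SACC
  have h12 : Runs (emit (vr (rVF q) .DST) (Sum.inr (q .SACC))) (base (fSt q T z11)) (base (fSt q T z12)) (8 * (2 * m * c) + 3) := by
    refine (runs_emit (h := vr (rVF q) .DST) (o := Sum.inr (q .SACC)) (by simp [hq]) (base (fSt q T z11))).of_eq ?_ ?_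
    · simp [z11, z12, pushItem, dbl]
    · have : (fSt q T z11 (rVF q .DST)).length ≤ 2 * m * (2 * n) := by simp [z11, hlr2]
      change 4 * (fSt q T z11 (rVF q .DST)).length + 3 ≤ _
      omega
  refine (h1.seq (h2.seq (h3.seq (h4.seq (h5.seq (h6.seq (h7.seq (h8.seq (h9.seq (h10.seq (h11.seq h12))))))))))).of_eq ?_ ?_
  · simp only [z12, hr1, hr2, hsh, hzl1, hzl2, hzd, hzx1, hzx2]
  · have hA : vArithCost n (2 * m) = 1050 * (2 * m * c) + 5 := by unfold vArithCost; rw [← hc3]; ring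
    have hS : vShiftCost n (2 * m) = 400 * (2 * m * c) + 250 * c := by unfold vShiftCost; rw [← hc3]; ring
    have hP : pairCost n m = 2700 * (2 * m * c) + 300 * c := by unfold pairCost; rw [← hc3]; ring
    rw [hA, hS, hP]
    omega

/-! ### The inverse pair operation -/

/-- The inverse pair operation: with the next `b` of `IN` and the next `a` of `HOLD2`, emit
`(a + b)·2⁻¹` onto `OACC` and `x^{4m−E}·(a − b)·2⁻¹` onto `SACC` (the constant `2⁻¹ mod N` in
`C`, `E` in `E`, `4m` in `M4`; `E` is saved in `T1` and restored). [folklore] -/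
def pairInv : Com (EReg ⊕ β) :=
  readItemTo (Sum.inr (q .IN)) (Sum.inr (q .X1)) (vr (rVF q) .W) (vr (rVF q) .TT) ;;
  (readItemTo (Sum.inr (q .HOLD2)) (Sum.inr (q .X2)) (vr (rVF q) .W) (vr (rVF q) .TT) ;;
  (copy (Sum.inr (q .X2)) (vr (rVF q) .L1) (ra .t) (ra .u) ;;
  (copy (Sum.inr (q .X1)) (vr (rVF q) .L2) (ra .t) (ra .u) ;;
  (vAddMod (rVF q) ;;
  (move (vr (rVF q) .DST) (vr (rVF q) .L1) (ra .s) ;;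
  (vScaleMod (rVF q) ;;
  (emit (vr (rVF q) .DST) (Sum.inr (q .OACC)) ;;
  (move (Sum.inr (q .X2)) (vr (rVF q) .L1) (ra .s) ;;
  (move (Sum.inr (q .X1)) (vr (rVF q) .L2) (ra .s) ;;
  (vSubMod (rVF q) ;;
  (move (vr (rVF q) .DST) (vr (rVF q) .L1) (ra .s) ;;
  (vScaleMod (rVF q) ;;
  (move (vr (rVF q) .DST) (vr (rVF q) .L1) (ra .s) ;;
  (copy (vr (rVF q) .E) (Sum.inr (q .T1)) (ra .t) (ra .u) ;;
  ((NS.op (.sub (rVF q .E) (q .M4) (q .T1)) : NS β).com ;;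
  (vNegShift (rVF q) ;;
  (emit (vr (rVF q) .DST) (Sum.inr (q .SACC)) ;;
  (clear (vr (rVF q) .E) ;;
  move (Sum.inr (q .T1)) (vr (rVF q) .E) (ra .s)))))))))))))))))))

/-- Cost of an inverse pair operation on blocks of length `2m`. [folklore] -/
def pairInvCost (n m : ℕ) : ℕ := (2 * m) * (4800 * (n + 1) ^ 3) + 500 * (n + 1) ^ 3

/-- **The inverse pair operation.** [folklore] -/
theorem runs_pairInv {N n m E i2 : ℕ} (hn : (encodeNat N).length + 1 ≤ n)
    (hm4n : (encodeNat (4 * m)).length + 1 ≤ n) (hE : E < 4 * m) (hE1 : 1 ≤ E) (hi2 : i2 < N) (T : Regs β)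
    (hI : LvlInv q N m (encodeNat i2) T)
    (z : FSlots) {u w : List ℕ} {us ws : List (List ℕ)} (hu : u.length = 2 * m ∧ ∀ a ∈ u, a < N)
    (hw : w.length = 2 * m ∧ ∀ a ∈ w, a < N) (hzin : z.inp = encBlocks (w :: ws)) (hzh2 : z.hold2 = encBlocks (u :: us))
    (hze : z.e = encodeNat E) (hzl1 : z.l1 = []) (hzl2 : z.l2 = []) (hzd : z.dst = []) (hzx1 : z.x1 = []) (hzx2 : z.x2 = [])
    (hzt1 : z.t1 = []) :
    Runs (pairInv q) (base (fSt q T z))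
      (base (fSt q T { z with inp := encBlocks ws, hold2 := encBlocks us, oacc := pushItem (vscaleMod N i2 (vaddMod N u w)) z.oacc, sacc := pushItem (negShift N (2 * m) (4 * m - E) (vscaleMod N i2 (vsubMod N u w))) z.sacc }))
      (pairInvCost n m) := by
  have hq : ∀ {i j : FReg}, i ≠ j → q i ≠ q j := fun h => q.injective.ne h
  obtain ⟨hMD, hLEN, hC, -, hM4, hA, hB, hD, hF, hG, hW, hTT, hO, hS, hU⟩ := hI
  have rd : ∀ (z : FSlots) (x : VReg), x ≠ .E → x ≠ .L1 → x ≠ .L2 → x ≠ .DST →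
      fSt q T z (q (.n (.v x))) = T (q (.n (.v x))) := fun z x h1 h2 h3 h4 => fSt_v q T z h1 h2 h3 h4
  have hN : 0 < N := by omega
  have hmn : (encodeNat (2 * m)).length + 1 ≤ n :=
    (Nat.add_le_add_right (Brick.length_encodeNat_mono (by omega : 2 * m ≤ 4 * m)) 1).trans hm4n
  set c := (n + 1) ^ 3 with hc3
  have hc : n + 1 ≤ c := succ_le_cube n
  have hlE : (encodeNat E).length ≤ n - 1 := (Brick.length_encodeNat_mono hE.le).trans (by omega)
  have hlE' : (encodeNat (4 * m - E)).length ≤ n - 1 := (Brick.length_encodeNat_mono (Nat.sub_le _ _)).trans (by omega)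
  -- the intermediate blocks
  set sm := vaddMod N u w with hsm
  set p1 := vscaleMod N i2 sm with hp1
  set d := vsubMod N u w with hd
  set ds := vscaleMod N i2 d with hds
  set r := negShift N (2 * m) (4 * m - E) ds with hr
  have hsmB : sm.length = 2 * m ∧ ∀ a ∈ sm, a < N :=
    ⟨by rw [hsm, length_vaddMod, hu.1, hw.1, min_self], fun a ha => lt_of_mem_vaddMod hN ha⟩
  have hp1B : p1.length = 2 * m ∧ ∀ a ∈ p1, a < N := ⟨by rw [hp1, length_vscaleMod, hsmB.1], fun a ha => lt_of_mem_vscaleMod hN ha⟩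
  have hdB : d.length = 2 * m ∧ ∀ a ∈ d, a < N :=
    ⟨by rw [hd, length_vsubMod, hu.1, hw.1, min_self], fun a ha => lt_of_mem_vsubMod hN ha⟩
  have hdsB : ds.length = 2 * m ∧ ∀ a ∈ ds, a < N := ⟨by rw [hds, length_vscaleMod, hdB.1], fun a ha => lt_of_mem_vscaleMod hN ha⟩
  have hrB : r.length = 2 * m ∧ ∀ a ∈ r, a < N := ⟨length_negShift hdsB.1, fun a ha => lt_of_mem_negShift hN hdsB.2 ha⟩
  have hlw := length_encVec_block hw hn
  have hlu := length_encVec_block hu hn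
  have hlsm := length_encVec_block hsmB hn
  have hlp1 := length_encVec_block hp1B hn
  have hld := length_encVec_block hdB hn
  have hlds := length_encVec_block hdsB hn
  have hlr := length_encVec_block hrB hn
  have hLc : 2 * m * (2 * n) ≤ 2 * (2 * m * c) :=
    calc 2 * m * (2 * n) = 2 * (2 * m * n) := by ring
      _ ≤ 2 * (2 * m * c) := Nat.mul_le_mul_left 2 (Nat.mul_le_mul_left _ (by omega))
  -- records (all explicit from `z`)
  let z1 : FSlots := { z with inp := encBlocks ws, x1 := encVec w }
  let z2 : FSlots := { z with inp := encBlocks ws, x1 := encVec w, hold2 := encBlocks us, x2 := encVec u }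
  let z3 : FSlots := { z with inp := encBlocks ws, x1 := encVec w, hold2 := encBlocks us, x2 := encVec u, l1 := encVec u }
  let z4 : FSlots := { z with inp := encBlocks ws, x1 := encVec w, hold2 := encBlocks us, x2 := encVec u, l1 := encVec u, l2 := encVec w }
  let z5 : FSlots := { z with inp := encBlocks ws, x1 := encVec w, hold2 := encBlocks us, x2 := encVec u, l1 := [], l2 := [], dst := encVec sm }
  let z6 : FSlots := { z with inp := encBlocks ws, x1 := encVec w, hold2 := encBlocks us, x2 := encVec u, l1 := encVec sm, l2 := [], dst := [] }
  let z7 : FSlots := { z with inp := encBlocks ws, x1 := encVec w, hold2 := encBlocks us, x2 := encVec u, l1 := [], l2 := [], dst := encVec p1 }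
  let z8 : FSlots := { z with inp := encBlocks ws, x1 := encVec w, hold2 := encBlocks us, x2 := encVec u, l1 := [], l2 := [], dst := [], oacc := pushItem p1 z.oacc }
  let z9 : FSlots := { z with inp := encBlocks ws, x1 := encVec w, hold2 := encBlocks us, x2 := [], l1 := encVec u, l2 := [], dst := [], oacc := pushItem p1 z.oacc }
  let z10 : FSlots := { z with inp := encBlocks ws, x1 := [], hold2 := encBlocks us, x2 := [], l1 := encVec u, l2 := encVec w, dst := [], oacc := pushItem p1 z.oacc }
  let z11 : FSlots := { z with inp := encBlocks ws, x1 := [], hold2 := encBlocks us, x2 := [], l1 := [], l2 := [], dst := encVec d, oacc := pushItem p1 z.oacc }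
  let z12 : FSlots := { z with inp := encBlocks ws, x1 := [], hold2 := encBlocks us, x2 := [], l1 := encVec d, l2 := [], dst := [], oacc := pushItem p1 z.oacc }
  let z13 : FSlots := { z with inp := encBlocks ws, x1 := [], hold2 := encBlocks us, x2 := [], l1 := [], l2 := [], dst := encVec ds, oacc := pushItem p1 z.oacc }
  let z14 : FSlots := { z with inp := encBlocks ws, x1 := [], hold2 := encBlocks us, x2 := [], l1 := encVec ds, l2 := [], dst := [], oacc := pushItem p1 z.oacc }
  let z15 : FSlots := { z with inp := encBlocks ws, x1 := [], hold2 := encBlocks us, x2 := [], l1 := encVec ds, l2 := [], dst := [], oacc := pushItem p1 z.oacc, t1 := encodeNat E }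
  let z16 : FSlots := { z with inp := encBlocks ws, x1 := [], hold2 := encBlocks us, x2 := [], l1 := encVec ds, l2 := [], dst := [], oacc := pushItem p1 z.oacc, t1 := encodeNat E, e := encodeNat (4 * m - E) }
  let z17 : FSlots := { z with inp := encBlocks ws, x1 := [], hold2 := encBlocks us, x2 := [], l1 := [], l2 := [], dst := encVec r, oacc := pushItem p1 z.oacc, t1 := encodeNat E, e := encodeNat (4 * m - E) }
  let z18 : FSlots := { z with inp := encBlocks ws, x1 := [], hold2 := encBlocks us, x2 := [], l1 := [], l2 := [], dst := [], oacc := pushItem p1 z.oacc, t1 := encodeNat E, e := encodeNat (4 * m - E), sacc := pushItem r z.sacc }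
  let z19 : FSlots := { z with inp := encBlocks ws, x1 := [], hold2 := encBlocks us, x2 := [], l1 := [], l2 := [], dst := [], oacc := pushItem p1 z.oacc, t1 := encodeNat E, e := [], sacc := pushItem r z.sacc }
  let z20 : FSlots := { z with inp := encBlocks ws, x1 := [], hold2 := encBlocks us, x2 := [], l1 := [], l2 := [], dst := [], oacc := pushItem p1 z.oacc, t1 := [], e := encodeNat E, sacc := pushItem r z.sacc }
  -- 1–2. read `w` and `u`
  have h1 : Runs (readItemTo (Sum.inr (q .IN)) (Sum.inr (q .X1)) (vr (rVF q) .W) (vr (rVF q) .TT)) (base (fSt q T z))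
      (base (fSt q T z1)) (22 * (2 * m * c) + 9) := by
    refine (runs_readItemTo (by simp [hq]) (by simp [hq]) (by simp [hq]) (by simp [hq]) (by simp [hq]) (encVec w) (encBlocks ws)
      (base (fSt q T z)) (by simp [hzin, encBlocks_cons]) (by simp [rd _ .W, hW]) (by simp [rd _ .TT, hTT])).of_eq
      (by simp [z1, hzx1]) ?_
    omega
  have h2 : Runs (readItemTo (Sum.inr (q .HOLD2)) (Sum.inr (q .X2)) (vr (rVF q) .W) (vr (rVF q) .TT)) (base (fSt q T z1))
      (base (fSt q T z2)) (22 * (2 * m * c) + 9) := by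
    refine (runs_readItemTo (by simp [hq]) (by simp [hq]) (by simp [hq]) (by simp [hq]) (by simp [hq]) (encVec u) (encBlocks us)
      (base (fSt q T z1)) (by simp [z1, hzh2, encBlocks_cons]) (by simp [rd _ .W, hW]) (by simp [rd _ .TT, hTT])).of_eq
      (by simp [z1, z2, hzx2]) ?_
    omega
  -- 3. copies
  have h3 : Runs (copy (Sum.inr (q .X2)) (vr (rVF q) .L1) (ra .t) (ra .u)) (base (fSt q T z2)) (base (fSt q T z3)) (20 * (2 * m * c) + 3) := by
    refine (runs_ocopy (a := q .X2) (b := rVF q .L1) (by simp [hq]) (fSt q T z2)).of_eq (by simp [z2, z3, hzl1]) ?_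
    have : (fSt q T z2 (q .X2)).length ≤ 2 * m * (2 * n) := by simp [z2, hlu]
    omega
  have h4 : Runs (copy (Sum.inr (q .X1)) (vr (rVF q) .L2) (ra .t) (ra .u)) (base (fSt q T z3)) (base (fSt q T z4)) (20 * (2 * m * c) + 3) := by
    refine (runs_ocopy (a := q .X1) (b := rVF q .L2) (by simp [hq]) (fSt q T z3)).of_eq (by simp [z3, z4, hzl2]) ?_
    have : (fSt q T z3 (q .X1)).length ≤ 2 * m * (2 * n) := by simp [z3, hlw]
    omega
  -- 4. add, move, scale, emit
  have h5 : Runs (vAddMod (rVF q)) (base (fSt q T z4)) (base (fSt q T z5)) (vArithCost n (2 * m)) := by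
    have h := runs_vAddMod (rVF q) hn (fSt q T z4) (u := u) (v := w) (by rw [hu.1, hw.1]) hu.2 hw.2 (by simp [z4])
      (by simp [z4]) (by simp [rd _ .MD, hMD]) (by simp [rd _ .A, hA]) (by simp [rd _ .B, hB]) (by simp [rd _ .D, hD])
      (by simp [rd _ .F, hF]) (by simp [rd _ .W, hW]) (by simp [rd _ .TT, hTT]) (by simp [rd _ .O, hO])
    rw [hu.1] at h
    exact h.of_eq (by simp [z4, z5, hzd, hsm]) le_rfl
  have h6 : Runs (move (vr (rVF q) .DST) (vr (rVF q) .L1) (ra .s)) (base (fSt q T z5)) (base (fSt q T z6)) (12 * (2 * m * c) + 2) := by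
    refine (runs_omove (a := rVF q .DST) (b := rVF q .L1) (by simp [hq]) (fSt q T z5)).of_eq (by simp [z5, z6]) ?_
    have : (fSt q T z5 (rVF q .DST)).length ≤ 2 * m * (2 * n) := by simp [z5, hlsm]
    omega
  have h7 : Runs (vScaleMod (rVF q)) (base (fSt q T z6)) (base (fSt q T z7)) (vArithCost n (2 * m)) := by
    have h := runs_vScaleMod (rVF q) hn hi2 (fSt q T z6) (u := sm) hsmB.2 (by simp [z6]) (by simp [rd _ .MD, hMD])
      (by simp [rd _ .C, hC]) (by simp [rd _ .A, hA]) (by simp [rd _ .B, hB]) (by simp [rd _ .D, hD])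
      (by simp [rd _ .F, hF]) (by simp [rd _ .W, hW]) (by simp [rd _ .TT, hTT]) (by simp [rd _ .O, hO])
    rw [hsmB.1] at h
    exact h.of_eq (by simp [z6, z7, hp1]) le_rfl
  have h8 : Runs (emit (vr (rVF q) .DST) (Sum.inr (q .OACC))) (base (fSt q T z7)) (base (fSt q T z8)) (8 * (2 * m * c) + 3) := by
    refine (runs_emit (h := vr (rVF q) .DST) (o := Sum.inr (q .OACC)) (by simp [hq]) (base (fSt q T z7))).of_eq ?_ ?_
    · simp [z7, z8, pushItem, dbl]
    · have : (fSt q T z7 (rVF q .DST)).length ≤ 2 * m * (2 * n) := by simp [z7, hlp1]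
      change 4 * (fSt q T z7 (rVF q .DST)).length + 3 ≤ _
      omega
  -- 5. subtract, scale
  have h9 : Runs (move (Sum.inr (q .X2)) (vr (rVF q) .L1) (ra .s)) (base (fSt q T z8)) (base (fSt q T z9)) (12 * (2 * m * c) + 2) := by
    refine (runs_omove (a := q .X2) (b := rVF q .L1) (by simp [hq]) (fSt q T z8)).of_eq (by simp [z8, z9]) ?_
    have : (fSt q T z8 (q .X2)).length ≤ 2 * m * (2 * n) := by simp [z8, hlu]
    omega
  have h10 : Runs (move (Sum.inr (q .X1)) (vr (rVF q) .L2) (ra .s)) (base (fSt q T z9)) (base (fSt q T z10)) (12 * (2 * m * c) + 2) := by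
    refine (runs_omove (a := q .X1) (b := rVF q .L2) (by simp [hq]) (fSt q T z9)).of_eq (by simp [z9, z10]) ?_
    have : (fSt q T z9 (q .X1)).length ≤ 2 * m * (2 * n) := by simp [z9, hlw]
    omega
  have h11 : Runs (vSubMod (rVF q)) (base (fSt q T z10)) (base (fSt q T z11)) (vArithCost n (2 * m)) := by
    have h := runs_vSubMod (rVF q) hn (fSt q T z10) (u := u) (v := w) (by rw [hu.1, hw.1]) hu.2 hw.2 (by simp [z10])
      (by simp [z10]) (by simp [rd _ .MD, hMD]) (by simp [rd _ .A, hA]) (by simp [rd _ .B, hB]) (by simp [rd _ .D, hD])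
      (by simp [rd _ .F, hF]) (by simp [rd _ .W, hW]) (by simp [rd _ .TT, hTT]) (by simp [rd _ .O, hO])
    rw [hu.1] at h
    exact h.of_eq (by simp [z10, z11, hd]) le_rfl
  have h12 : Runs (move (vr (rVF q) .DST) (vr (rVF q) .L1) (ra .s)) (base (fSt q T z11)) (base (fSt q T z12)) (12 * (2 * m * c) + 2) := by
    refine (runs_omove (a := rVF q .DST) (b := rVF q .L1) (by simp [hq]) (fSt q T z11)).of_eq (by simp [z11, z12]) ?_
    have : (fSt q T z11 (rVF q .DST)).length ≤ 2 * m * (2 * n) := by simp [z11, hld]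
    omega
  have h13 : Runs (vScaleMod (rVF q)) (base (fSt q T z12)) (base (fSt q T z13)) (vArithCost n (2 * m)) := by
    have h := runs_vScaleMod (rVF q) hn hi2 (fSt q T z12) (u := d) hdB.2 (by simp [z12]) (by simp [rd _ .MD, hMD])
      (by simp [rd _ .C, hC]) (by simp [rd _ .A, hA]) (by simp [rd _ .B, hB]) (by simp [rd _ .D, hD])
      (by simp [rd _ .F, hF]) (by simp [rd _ .W, hW]) (by simp [rd _ .TT, hTT]) (by simp [rd _ .O, hO])
    rw [hdB.1] at h
    exact h.of_eq (by simp [z12, z13, hds]) le_rfl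
  have h14 : Runs (move (vr (rVF q) .DST) (vr (rVF q) .L1) (ra .s)) (base (fSt q T z13)) (base (fSt q T z14)) (12 * (2 * m * c) + 2) := by
    refine (runs_omove (a := rVF q .DST) (b := rVF q .L1) (by simp [hq]) (fSt q T z13)).of_eq (by simp [z13, z14]) ?_
    have : (fSt q T z13 (rVF q .DST)).length ≤ 2 * m * (2 * n) := by simp [z13, hlds]
    omega
  -- 6. save `E`, `E := 4m - E`, shift, emit, restore `E`
  have h15 : Runs (copy (vr (rVF q) .E) (Sum.inr (q .T1)) (ra .t) (ra .u)) (base (fSt q T z14)) (base (fSt q T z15)) (11 * c) := by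
    refine (runs_ocopy (a := rVF q .E) (b := q .T1) (by simp [hq]) (fSt q T z14)).of_eq (by simp [z14, z15, hze, hzt1]) ?_
    have : (fSt q T z14 (rVF q .E)).length ≤ n - 1 := by simp [z14, hze, hlE]
    omega
  have h16 : Runs (NS.op (.sub (rVF q .E) (q .M4) (q .T1)) : NS β).com (base (fSt q T z15)) (base (fSt q T z16)) (71 * c) := by
    refine NS.runs_of_eq (N := n) _ _ ?_ ?_ (by simp [hc3])
    · simp only [NS.ok, NOp.ok, Function.Embedding.trans_apply, NReg.ιV_apply, FReg.ιN_apply, fSt_M4, hM4, fSt_T1, fSt_E,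
        z15, hze, bitsToNat_encodeNat]
      have h4l : (encodeNat (4 * m)).length ≤ n := by omega
      refine ⟨h4l, by omega, by omega, hE.le⟩
    · simp [z15, z16, hM4]
  have h17 : Runs (vNegShift (rVF q)) (base (fSt q T z16)) (base (fSt q T z17)) (vShiftCost n (2 * m)) := by
    have h := runs_vNegShift (rVF q) hn hmn (show 4 * m - E < 2 * (2 * m) by omega) (fSt q T z16) (u := ds) hdsB.2 hdsB.1
      (by simp [z16]) (by simp [rd _ .MD, hMD]) (by simp [z16]) (by simp [rd _ .LEN, hLEN]) (by simp [rd _ .A, hA])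
      (by simp [rd _ .B, hB]) (by simp [rd _ .D, hD]) (by simp [rd _ .F, hF]) (by simp [rd _ .G, hG]) (by simp [rd _ .W, hW])
      (by simp [rd _ .TT, hTT]) (by simp [rd _ .O, hO]) (by simp [rd _ .S, hS]) (by simp [rd _ .U, hU])
    exact h.of_eq (by simp [z16, z17, hr]) le_rfl
  have h18 : Runs (emit (vr (rVF q) .DST) (Sum.inr (q .SACC))) (base (fSt q T z17)) (base (fSt q T z18)) (8 * (2 * m * c) + 3) := by
    refine (runs_emit (h := vr (rVF q) .DST) (o := Sum.inr (q .SACC)) (by simp [hq]) (base (fSt q T z17))).of_eq ?_ ?_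
    · simp [z17, z18, pushItem, dbl]
    · have : (fSt q T z17 (rVF q .DST)).length ≤ 2 * m * (2 * n) := by simp [z17, hlr]
      change 4 * (fSt q T z17 (rVF q .DST)).length + 3 ≤ _
      omega
  have h19 : Runs (clear (vr (rVF q) .E)) (base (fSt q T z18)) (base (fSt q T z19)) (3 * c) := by
    refine (runs_clear (vr (rVF q) .E) (base (fSt q T z18))).of_eq (by simp [z18, z19]) ?_
    change 2 * (fSt q T z18 (rVF q .E)).length + 1 ≤ 3 * c
    have : (fSt q T z18 (rVF q .E)).length ≤ n - 1 := by simp [z18, hlE']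
    omega
  have h20 : Runs (move (Sum.inr (q .T1)) (vr (rVF q) .E) (ra .s)) (base (fSt q T z19)) (base (fSt q T z20)) (7 * c) := by
    refine (runs_omove (a := q .T1) (b := rVF q .E) (by simp [hq]) (fSt q T z19)).of_eq (by simp [z19, z20]) ?_
    have : (fSt q T z19 (q .T1)).length ≤ n - 1 := by simp [z19, hlE]
    omega
  refine (h1.seq (h2.seq (h3.seq (h4.seq (h5.seq (h6.seq (h7.seq (h8.seq (h9.seq (h10.seq (h11.seq (h12.seq (h13.seq (h14.seq
    (h15.seq (h16.seq (h17.seq (h18.seq (h19.seq h20))))))))))))))))))).of_eq ?_ ?_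
  · simp only [z20, hp1, hr, hsm, hds, hd, hzl1, hzl2, hzd, hzx1, hzx2, hzt1, hze]
  · have hA : vArithCost n (2 * m) = 1050 * (2 * m * c) + 5 := by unfold vArithCost; rw [← hc3]; ring
    have hS : vShiftCost n (2 * m) = 400 * (2 * m * c) + 250 * c := by unfold vShiftCost; rw [← hc3]; ring
    have hP : pairInvCost n m = 4800 * (2 * m * c) + 500 * c := by unfold pairInvCost; rw [← hc3]; ring
    rw [hA, hS, hP]
    linarith [hc, Nat.zero_le (2 * m * c)]

/-! ### Pair operations abstractly, and the zip loop of a segment -/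

/-- Pushing the results of a binary block operation over two lists of blocks onto a reversed
accumulator, in order. [folklore] -/
def _root_.Literature.Computability.Complexity.pushAll (f : List ℕ → List ℕ → List ℕ) :
    List (List ℕ) → List (List ℕ) → List Bool → List Bool
  | [], _, acc => acc
  | _ :: _, [], acc => acc
  | u :: us, w :: ws, acc => pushAll f us ws (pushItem (f u w) acc)

/-- `pushAll` extends a reversed accumulator of emitted blocks by the `zipWith`. [folklore] -/
theorem _root_.Literature.Computability.Complexity.pushAll_outRev (f : List ℕ → List ℕ → List ℕ) :
    ∀ (us ws : List (List ℕ)) (D : List (List ℕ)), us.length = ws.length →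
      pushAll f us ws (outRev (D.map encVec)) = outRev ((D ++ List.zipWith f us ws).map encVec)
  | [], [], D, _ => by simp [pushAll]
  | [], _ :: _, _, h => by simp at h
  | _ :: _, [], _, h => by simp at h
  | u :: us, w :: ws, D, h => by
    rw [pushAll, ← outRev_map_encVec_append, pushAll_outRev f us ws (D ++ [f u w]) (by simpa using h),
      List.zipWith_cons_cons, List.append_assoc, List.singleton_append]

/-- `PairOp q body T N m g₁ g₂ c`: over the base file `T`, `body` is a pair operation — it
consumes the next blocks `u` of `HOLD2` and `w` of `IN` (valid blocks of length `2m`), emits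
`g₁ E u w` onto `OACC` and `g₂ E u w` onto `SACC` (`E` the exponent in `E`, `1 ≤ E < 4m`),
leaves the scratch slots `L1 L2 DST X1 X2 T1` empty as it found them, within `c` steps.
[folklore] -/
def PairOp (body : Com (EReg ⊕ β)) (T : Regs β) (N m : ℕ) (g₁ g₂ : ℕ → List ℕ → List ℕ → List ℕ) (c : ℕ) : Prop :=
  ∀ (z : FSlots) (E : ℕ) (u w : List ℕ) (us ws : List (List ℕ)), E < 4 * m → 1 ≤ E →
    (u.length = 2 * m ∧ ∀ a ∈ u, a < N) → (w.length = 2 * m ∧ ∀ a ∈ w, a < N) →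
    z.inp = encBlocks (w :: ws) → z.hold2 = encBlocks (u :: us) → z.e = encodeNat E →
    z.l1 = [] → z.l2 = [] → z.dst = [] → z.x1 = [] → z.x2 = [] → z.t1 = [] →
    Runs body (base (fSt q T z))
      (base (fSt q T { z with inp := encBlocks ws, hold2 := encBlocks us, oacc := pushItem (g₁ E u w) z.oacc, sacc := pushItem (g₂ E u w) z.sacc })) c

/-- The forward pair operation is a pair operation. [folklore] -/
theorem pairOp_pairFwd {N n m : ℕ} {cw : List Bool} (hn : (encodeNat N).length + 1 ≤ n)
    (hmn : (encodeNat (2 * m)).length + 1 ≤ n) (T : Regs β) (hI : LvlInv q N m cw T) :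
    PairOp q (pairFwd q) T N m (fun E u w => vaddMod N u (negShift N (2 * m) E w))
      (fun E u w => vsubMod N u (negShift N (2 * m) E w)) (pairCost n m) :=
  fun z _ _ _ _ _ hE _ hu hw hzin hzh2 hze hzl1 hzl2 hzd hzx1 hzx2 _ =>
    runs_pairFwd q hn hmn hE T hI z hu hw hzin hzh2 hze hzl1 hzl2 hzd hzx1 hzx2

/-- The inverse pair operation is a pair operation. [folklore] -/
theorem pairOp_pairInv {N n m i2 : ℕ} (hn : (encodeNat N).length + 1 ≤ n)
    (hm4n : (encodeNat (4 * m)).length + 1 ≤ n) (hi2 : i2 < N) (T : Regs β) (hI : LvlInv q N m (encodeNat i2) T) :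
    PairOp q (pairInv q) T N m (fun _ u w => vscaleMod N i2 (vaddMod N u w))
      (fun E u w => negShift N (2 * m) (4 * m - E) (vscaleMod N i2 (vsubMod N u w))) (pairInvCost n m) :=
  fun z _ _ _ _ _ hE hE1 hu hw hzin hzh2 hze hzl1 hzl2 hzd hzx1 hzx2 hzt1 =>
    runs_pairInv q hn hm4n hE hE1 hi2 T hI z hu hw hzin hzh2 hze hzl1 hzl2 hzd hzx1 hzx2 hzt1

/-- **The zip loop of a segment**: with `1ᵏ` on `CNT`, the `k` blocks `us` (as items) in
`HOLD2` and `IN = encBlocks (ws ++ rest)` with `|ws| = k`, the counted loop of a pair operation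
consumes `us` and `ws` and pushes the results onto the two accumulators in order. [folklore] -/
theorem runs_pairLoop {body : Com (EReg ⊕ β)} {T : Regs β} {N m : ℕ} {g₁ g₂ : ℕ → List ℕ → List ℕ → List ℕ} {c : ℕ}
    (hP : PairOp q body T N m g₁ g₂ c) (z : FSlots) {E : ℕ} (hE : E < 4 * m) (hE1 : 1 ≤ E)
    {us ws rest : List (List ℕ)} (hus : ∀ u ∈ us, u.length = 2 * m ∧ ∀ a ∈ u, a < N)
    (hws : ∀ w ∈ ws, w.length = 2 * m ∧ ∀ a ∈ w, a < N) (hlen : us.length = ws.length)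
    (hzin : z.inp = encBlocks (ws ++ rest)) (hzh2 : z.hold2 = encBlocks us) (hze : z.e = encodeNat E)
    (hzl1 : z.l1 = []) (hzl2 : z.l2 = []) (hzd : z.dst = []) (hzx1 : z.x1 = []) (hzx2 : z.x2 = []) (hzt1 : z.t1 = [])
    (hzc : z.cnt = List.replicate us.length true) :
    Runs (countLoop (Sum.inr (q .CNT)) body) (base (fSt q T z))
      (base (fSt q T { z with inp := encBlocks rest, hold2 := [], cnt := [], oacc := pushAll (g₁ E) us ws z.oacc, sacc := pushAll (g₂ E) us ws z.sacc }))
      (us.length * (c + 2) + 1) := by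
  have hq : ∀ {i j : FReg}, i ≠ j → q i ≠ q j := fun h => q.injective.ne h
  -- state after a prefix: remaining `us'`, `ws'`, accumulators extended by the processed prefix
  let st : List (List ℕ) → List (List ℕ) → List Bool → List Bool → Regs β := fun us' ws' o sa =>
    fSt q T { z with inp := encBlocks (ws' ++ rest), hold2 := encBlocks us', cnt := List.replicate us'.length true, oacc := o, sacc := sa }
  have h := runs_countLoop (U := Sum.inr (q .CNT)) (body := body)
    (fun k R => ∃ us' ws' o sa, us'.length = k ∧ ws'.length = k ∧ (∀ u ∈ us', u ∈ us) ∧ (∀ w ∈ ws', w ∈ ws) ∧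
      pushAll (g₁ E) us' ws' o = pushAll (g₁ E) us ws z.oacc ∧ pushAll (g₂ E) us' ws' sa = pushAll (g₂ E) us ws z.sacc ∧
      R = base (st us' ws' o sa)) c
    (by
      rintro k R ⟨us', ws', o, sa, hku, hkw, hsu, hsw, ho, hsa, rfl⟩ -
      obtain ⟨u, us'', rfl⟩ : ∃ u t, us' = u :: t := by
        cases us' with
        | nil => simp at hku
        | cons u t => exact ⟨u, t, rfl⟩
      obtain ⟨w, ws'', rfl⟩ : ∃ w t, ws' = w :: t := by
        cases ws' with
        | nil => simp at hkw
        | cons w t => exact ⟨w, t, rfl⟩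
      simp only [List.length_cons, Nat.add_right_cancel_iff] at hku hkw
      have e1 : Function.update (base (st (u :: us'') (w :: ws'') o sa)) (Sum.inr (q .CNT)) (List.replicate k true) =
          base (fSt q T { z with inp := encBlocks (w :: (ws'' ++ rest)), hold2 := encBlocks (u :: us''), cnt := List.replicate k true, oacc := o, sacc := sa }) := by
        simp [st]
      rw [e1]
      have hb := hP { z with inp := encBlocks (w :: (ws'' ++ rest)), hold2 := encBlocks (u :: us''), cnt := List.replicate k true, oacc := o, sacc := sa }
        E u w us'' (ws'' ++ rest) hE hE1 (hus u (hsu u (by simp))) (hws w (hsw w (by simp))) rfl rfl hze hzl1 hzl2 hzd hzx1 hzx2 hzt1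
      refine ⟨base (st us'' ws'' (pushItem (g₁ E u w) o) (pushItem (g₂ E u w) sa)), hb.of_eq ?_ le_rfl, by simp [st, hku],
        us'', ws'', _, _, hku, hkw, fun x hx => hsu x (by simp [hx]), fun x hx => hsw x (by simp [hx]), ?_, ?_, rfl⟩
      · simp [st, hku]
      · rw [← ho, pushAll]
      · rw [← hsa, pushAll])
    us.length (base (st us ws z.oacc z.sacc)) ⟨us, ws, z.oacc, z.sacc, rfl, hlen.symm, fun _ h => h, fun _ h => h, rfl, rfl, rfl⟩
    (by simp [st])
  obtain ⟨R', hR, -, us', ws', o, sa, hku, hkw, -, -, ho, hsa, rfl⟩ := h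
  obtain rfl : us' = [] := List.eq_nil_of_length_eq_zero hku
  obtain rfl : ws' = [] := List.eq_nil_of_length_eq_zero hkw
  rw [pushAll] at ho hsa
  have e0 : base (st us ws z.oacc z.sacc) = base (fSt q T z) := by
    simp only [st, ← hzin, ← hzh2, ← hzc]
  rw [e0] at hR
  refine hR.of_eq ?_ le_rfl
  simp only [st, List.nil_append, encBlocks_nil, List.length_nil, List.replicate_zero, ho, hsa]

/-! ### Moving a run of blocks onto a buffer as items -/

/-- The block-move round: read the next block of `IN` and emit it onto `HOLD`. [folklore] -/
def moveBlock : Com (EReg ⊕ β) :=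
  readItemTo (Sum.inr (q .IN)) (Sum.inr (q .TMP)) (vr (rVF q) .W) (vr (rVF q) .TT) ;; emit (Sum.inr (q .TMP)) (Sum.inr (q .HOLD))

/-- Pushing blocks one by one onto a reversed accumulator. [folklore] -/
def _root_.Literature.Computability.Complexity.pushBlocks : List (List ℕ) → List Bool → List Bool
  | [], acc => acc
  | b :: bs, acc => pushBlocks bs (pushItem b acc)

/-- `pushBlocks` onto a reversed accumulator of emitted blocks. [folklore] -/
theorem _root_.Literature.Computability.Complexity.pushBlocks_outRev :
    ∀ (bs D : List (List ℕ)), pushBlocks bs (outRev (D.map encVec)) = outRev ((D ++ bs).map encVec)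
  | [], D => by simp [pushBlocks]
  | b :: bs, D => by
    rw [pushBlocks, ← outRev_map_encVec_append, pushBlocks_outRev bs (D ++ [b]), List.append_assoc, List.singleton_append]

/-- **The block-move loop**: with `1ᵏ` on `CNT` and `IN = encBlocks (bs ++ rest)`, `|bs| = k`,
the counted loop of `moveBlock` pushes the blocks of `bs` onto `HOLD` in order (scratch
`TMP` empty, `W`, `TT` empty in the base). [folklore] -/
theorem runs_moveBlocks {N n m : ℕ} (hn : (encodeNat N).length + 1 ≤ n) (T : Regs β)
    (hW : T (q (.n (.v .W))) = []) (hTT : T (q (.n (.v .TT))) = []) (z : FSlots)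
    {bs rest : List (List ℕ)} (hbs : ∀ b ∈ bs, b.length = 2 * m ∧ ∀ a ∈ b, a < N)
    (hzin : z.inp = encBlocks (bs ++ rest)) (hzt : z.tmp = []) (hzc : z.cnt = List.replicate bs.length true) :
    Runs (countLoop (Sum.inr (q .CNT)) (moveBlock q)) (base (fSt q T z))
      (base (fSt q T { z with inp := encBlocks rest, cnt := [], hold := pushBlocks bs z.hold }))
      (bs.length * (38 * (2 * m * (2 * n)) + 14) + 1) := by
  have hq : ∀ {i j : FReg}, i ≠ j → q i ≠ q j := fun h => q.injective.ne h
  have rdW : ∀ z : FSlots, fSt q T z (q (.n (.v .W))) = [] := fun z => by rw [fSt_v q T z] <;> first | decide | exact hW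
  have rdTT : ∀ z : FSlots, fSt q T z (q (.n (.v .TT))) = [] := fun z => by rw [fSt_v q T z] <;> first | decide | exact hTT
  let st : List (List ℕ) → List Bool → Regs β := fun bs' ho =>
    fSt q T { z with inp := encBlocks (bs' ++ rest), cnt := List.replicate bs'.length true, hold := ho }
  have h := runs_countLoop (U := Sum.inr (q .CNT)) (body := moveBlock q)
    (fun k R => ∃ bs' ho, bs'.length = k ∧ (∀ b ∈ bs', b ∈ bs) ∧ pushBlocks bs' ho = pushBlocks bs z.hold ∧ R = base (st bs' ho))
    (38 * (2 * m * (2 * n)) + 12)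
    (by
      rintro k R ⟨bs', ho, hk, hsub, hpush, rfl⟩ -
      obtain ⟨b, bs'', rfl⟩ : ∃ b t, bs' = b :: t := by
        cases bs' with
        | nil => simp at hk
        | cons b t => exact ⟨b, t, rfl⟩
      simp only [List.length_cons, Nat.add_right_cancel_iff] at hk
      have hb := hbs b (hsub b (by simp))
      have hlb := length_encVec_block hb hn
      have e1 : Function.update (base (st (b :: bs'') ho)) (Sum.inr (q .CNT)) (List.replicate k true) =
          base (fSt q T { z with inp := encBlocks (b :: (bs'' ++ rest)), cnt := List.replicate k true, hold := ho }) := by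
        simp [st]
      rw [e1]
      set zz : FSlots := { z with inp := encBlocks (b :: (bs'' ++ rest)), cnt := List.replicate k true, hold := ho } with hzz
      have h1 : Runs (readItemTo (Sum.inr (q .IN)) (Sum.inr (q .TMP)) (vr (rVF q) .W) (vr (rVF q) .TT)) (base (fSt q T zz))
          (base (fSt q T { zz with inp := encBlocks (bs'' ++ rest), tmp := encVec b })) (11 * (2 * m * (2 * n)) + 9) := by
        refine (runs_readItemTo (by simp [hq]) (by simp [hq]) (by simp [hq]) (by simp [hq]) (by simp [hq]) (encVec b)
          (encBlocks (bs'' ++ rest)) (base (fSt q T zz)) (by simp [hzz, encBlocks_cons]) (by simp [rdW]) (by simp [rdTT])).of_eq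
          (by simp [hzz, hzt]) ?_
        omega
      have h2 : Runs (emit (Sum.inr (q .TMP)) (Sum.inr (q .HOLD))) (base (fSt q T { zz with inp := encBlocks (bs'' ++ rest), tmp := encVec b }))
          (base (st bs'' (pushItem b ho))) (4 * (2 * m * (2 * n)) + 3) := by
        refine (runs_emit (h := Sum.inr (q .TMP)) (o := Sum.inr (q .HOLD)) (by simp [hq]) _).of_eq ?_ ?_
        · simp [st, hzz, hk, pushItem, dbl, hzt]
        · simp only [nst_inr, fSt_TMP]; omega
      refine ⟨_, (h1.seq h2).of_eq rfl (by omega), by simp [st, hk], bs'', pushItem b ho, hk, fun x hx => hsub x (by simp [hx]), ?_, rfl⟩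
      rw [← hpush, pushBlocks])
    bs.length (base (st bs z.hold)) ⟨bs, z.hold, rfl, fun _ h => h, rfl, rfl⟩ (by simp [st])
  obtain ⟨R', hR, -, bs', ho, hk, -, hpush, rfl⟩ := h
  obtain rfl : bs' = [] := List.eq_nil_of_length_eq_zero hk
  rw [pushBlocks] at hpush
  have e0 : base (st bs z.hold) = base (fSt q T z) := by simp only [st, ← hzin, ← hzc]
  rw [e0] at hR
  refine hR.of_eq ?_ (by nlinarith)
  simp only [st, List.nil_append, List.length_nil, List.replicate_zero, hpush]

/-! ### The three phases of a segment -/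

/-- `outRev` of a concatenation, as stacks: the later blocks sit on top. [folklore] -/
theorem _root_.Literature.Computability.Complexity.outRev_append_list (A B : List (List Bool)) :
    outRev (A ++ B) = outRev B ++ outRev A := by
  simp [outRev, List.reverse_append]

/-- The reverse of the code of a list of blocks is its reversed accumulator. [folklore] -/
theorem _root_.Literature.Computability.Complexity.reverse_encBlocks (Bs : List (List ℕ)) :
    (encBlocks Bs).reverse = outRev (Bs.map encVec) := by
  unfold encBlocks; rw [← reverse_outRev, List.reverse_reverse]

/-- Phase A of a segment: read the segment's twiddle exponent `F` from `TW`, halve it into `E`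
(drop the low bit of the even numeral), and emit the children `F/2`, `F/2 + 2m` onto `TWACC`.
[folklore] -/
def segTwiddle : Com (EReg ⊕ β) :=
  readItemTo (Sum.inr (q .TW)) (vr (rVF q) .E) (vr (rVF q) .W) (vr (rVF q) .TT) ;;
  ((NS.op (.drop (rVF q .E)) : NS β).com ;;
  (copy (vr (rVF q) .E) (Sum.inr (q .T1)) (ra .t) (ra .u) ;;
  (emit (Sum.inr (q .T1)) (Sum.inr (q .TWACC)) ;;
  ((NS.op (.add (q .T1) (rVF q .E) (q .M2)) : NS β).com ;;
  emit (Sum.inr (q .T1)) (Sum.inr (q .TWACC))))))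

/-- Phase B of a segment: move the first `h` blocks of `IN` (count in `HN`) onto `HOLD`, then
pour them as a forward list onto `HOLD2`. [folklore] -/
def segSplit : Com (EReg ⊕ β) :=
  nToUnary (q .CNT) (q .HN) ;; (countLoop (Sum.inr (q .CNT)) (moveBlock q) ;; pour (Sum.inr (q .HOLD)) (Sum.inr (q .HOLD2)))

/-- Phase C of a segment: the zip loop of the pair operation over `HOLD2` and `IN`, then the
second-half results are transferred from `SACC` onto `OACC` (two pours) and `E` is cleared.
[folklore] -/
def segZip (pairC : Com (EReg ⊕ β)) : Com (EReg ⊕ β) :=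
  nToUnary (q .CNT) (q .HN) ;; (countLoop (Sum.inr (q .CNT)) pairC ;;
  (pour (Sum.inr (q .SACC)) (Sum.inr (q .TMP)) ;; (pour (Sum.inr (q .TMP)) (Sum.inr (q .OACC)) ;; clear (vr (rVF q) .E))))

/-- A segment: phases A, B, C. [folklore] -/
def segBody (pairC : Com (EReg ⊕ β)) : Com (EReg ⊕ β) := segTwiddle q ;; (segSplit q ;; segZip q pairC)

/-- The item of a numeral pushed onto a reversed accumulator of numerals. [folklore] -/
theorem outRev_map_encodeNat_append (G : List ℕ) (x : ℕ) :
    outRev ((G ++ [x]).map encodeNat) = true :: false :: ((dbl (encodeNat x)).reverse ++ outRev (G.map encodeNat)) := by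
  rw [List.map_append, List.map_singleton, outRev_append]; rfl

/-- **Phase A.** With `TW = encVec (F :: Fs)` (`F = 2E`, `1 ≤ E`), `E` and `T1` empty:
`TW := encVec Fs`, `E := encodeNat E`, and the children `E`, `E + 2m` are emitted onto `TWACC`.
[folklore] -/
theorem runs_segTwiddle {n m E : ℕ} (hm4n : (encodeNat (4 * m)).length + 1 ≤ n) (hE : E < 4 * m) (hE1 : 1 ≤ E)
    (T : Regs β) (hM2 : T (q .M2) = encodeNat (2 * m)) (hW : T (q (.n (.v .W))) = []) (hTT : T (q (.n (.v .TT))) = [])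
    (z : FSlots) {Fs G : List ℕ} (hztw : z.tw = encVec (2 * E :: Fs)) (hze : z.e = []) (hzt1 : z.t1 = [])
    (hztwacc : z.twacc = outRev (G.map encodeNat)) :
    Runs (segTwiddle q) (base (fSt q T z))
      (base (fSt q T { z with tw := encVec Fs, e := encodeNat E, twacc := outRev ((G ++ [E, E + 2 * m]).map encodeNat) }))
      (200 * (n + 1) ^ 3) := by
  have hq : ∀ {i j : FReg}, i ≠ j → q i ≠ q j := fun h => q.injective.ne h
  have rdW : ∀ z : FSlots, fSt q T z (q (.n (.v .W))) = [] := fun z => by rw [fSt_v q T z] <;> first | decide | exact hW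
  have rdTT : ∀ z : FSlots, fSt q T z (q (.n (.v .TT))) = [] := fun z => by rw [fSt_v q T z] <;> first | decide | exact hTT
  set c := (n + 1) ^ 3 with hc3
  have hc : n + 1 ≤ c := succ_le_cube n
  have h2E : encodeNat (2 * E) = false :: encodeNat E := encodeNat_two_mul E (by omega)
  have hlE : (encodeNat E).length ≤ n - 1 := (Brick.length_encodeNat_mono hE.le).trans (by omega)
  have hl2E : (encodeNat (2 * E)).length ≤ n := by rw [h2E, List.length_cons]; omega
  have hlE2 : (encodeNat (E + 2 * m)).length ≤ n := by
    have := Brick.length_encodeNat_mono (show E + 2 * m ≤ 4 * m + 4 * m by omega)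
    have h8 : (encodeNat (4 * m + 4 * m)).length ≤ (encodeNat (4 * m)).length + 1 := by
      rcases Nat.eq_zero_or_pos m with rfl | hm
      · simp
      · rw [show 4 * m + 4 * m = 2 * (4 * m) by ring, encodeNat_two_mul _ (by omega), List.length_cons]
    omega
  have hM2l : (encodeNat (2 * m)).length ≤ n :=
    (Brick.length_encodeNat_mono (show 2 * m ≤ 4 * m by omega)).trans (by omega)
  let z1 : FSlots := { z with tw := encVec Fs, e := encodeNat (2 * E) }
  let z2 : FSlots := { z with tw := encVec Fs, e := encodeNat E }
  let z3 : FSlots := { z with tw := encVec Fs, e := encodeNat E, t1 := encodeNat E }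
  let z4 : FSlots := { z with tw := encVec Fs, e := encodeNat E, t1 := [], twacc := outRev ((G ++ [E]).map encodeNat) }
  let z5 : FSlots := { z with tw := encVec Fs, e := encodeNat E, t1 := encodeNat (E + 2 * m), twacc := outRev ((G ++ [E]).map encodeNat) }
  let z6 : FSlots := { z with tw := encVec Fs, e := encodeNat E, t1 := [], twacc := outRev ((G ++ [E] ++ [E + 2 * m]).map encodeNat) }
  have h1 : Runs (readItemTo (Sum.inr (q .TW)) (vr (rVF q) .E) (vr (rVF q) .W) (vr (rVF q) .TT)) (base (fSt q T z))
      (base (fSt q T z1)) (11 * c + 9) := by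
    refine (runs_readItemTo (by simp [hq]) (by simp [hq]) (by simp [hq]) (by simp [hq]) (by simp [hq]) (encodeNat (2 * E)) (encVec Fs)
      (base (fSt q T z)) (by simp [hztw, encVec_cons]) (by simp [rdW]) (by simp [rdTT])).of_eq (by simp [z1, hze]) ?_
    omega
  have h2 : Runs (NS.op (.drop (rVF q .E)) : NS β).com (base (fSt q T z1)) (base (fSt q T z2)) (2 * c) :=
    NS.runs_of_eq (N := n) _ _ (by simp) (by simp [z1, z2, h2E]) (by simp [hc3])
  have h3 : Runs (copy (vr (rVF q) .E) (Sum.inr (q .T1)) (ra .t) (ra .u)) (base (fSt q T z2)) (base (fSt q T z3)) (11 * c) := by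
    refine (runs_ocopy (a := rVF q .E) (b := q .T1) (by simp [hq]) (fSt q T z2)).of_eq (by simp [z2, z3, hzt1]) ?_
    have : (fSt q T z2 (rVF q .E)).length ≤ n - 1 := by simp [z2, hlE]
    omega
  have h4 : Runs (emit (Sum.inr (q .T1)) (Sum.inr (q .TWACC))) (base (fSt q T z3)) (base (fSt q T z4)) (5 * c) := by
    refine (runs_emit (h := Sum.inr (q .T1)) (o := Sum.inr (q .TWACC)) (by simp [hq]) _).of_eq ?_ ?_
    · simp [z3, z4, hztwacc, outRev_append]
    · simp only [nst_inr, fSt_T1, z3]; omega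
  have h5 : Runs (NS.op (.add (q .T1) (rVF q .E) (q .M2)) : NS β).com (base (fSt q T z4)) (base (fSt q T z5)) (65 * c) := by
    refine NS.runs_of_eq (N := n) _ _ ?_ (by simp [z4, z5, hM2]) (by simp [hc3])
    simp only [NS.ok, NOp.ok, Function.Embedding.trans_apply, NReg.ιV_apply, FReg.ιN_apply, fSt_E, fSt_M2, hM2, fSt_T1, z4]
    exact ⟨by omega, hM2l, by simp⟩
  have h6 : Runs (emit (Sum.inr (q .T1)) (Sum.inr (q .TWACC))) (base (fSt q T z5)) (base (fSt q T z6)) (5 * c) := by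
    refine (runs_emit (h := Sum.inr (q .T1)) (o := Sum.inr (q .TWACC)) (by simp [hq]) _).of_eq ?_ ?_
    · simp [z5, z6, outRev_append, outRev_append_two]
    · simp only [nst_inr, fSt_T1, z5]; omega
  refine (h1.seq (h2.seq (h3.seq (h4.seq (h5.seq h6))))).of_eq ?_ ?_
  · simp only [z6, List.append_assoc, List.cons_append, List.nil_append, hzt1]
  · omega

/-- **Phase B.** With `HN = encodeNat h`, `IN = encBlocks (us ++ rest)` (`|us| = h`), `CNT`, `TMP`,
`HOLD`, `HOLD2` empty: `IN := encBlocks rest`, `HOLD2 := encBlocks us`. [folklore] -/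
theorem runs_segSplit {N n m h : ℕ} (hn : (encodeNat N).length + 1 ≤ n) (hhn : (encodeNat h).length ≤ n) (T : Regs β)
    (hHN : T (q .HN) = encodeNat h) (hW : T (q (.n (.v .W))) = []) (hTT : T (q (.n (.v .TT))) = [])
    (z : FSlots) {us rest : List (List ℕ)} (hus : ∀ u ∈ us, u.length = 2 * m ∧ ∀ a ∈ u, a < N) (hlen : us.length = h)
    (hzin : z.inp = encBlocks (us ++ rest)) (hzt : z.tmp = []) (hzc : z.cnt = []) (hzh : z.hold = []) (hzh2 : z.hold2 = []) :
    Runs (segSplit q) (base (fSt q T z)) (base (fSt q T { z with inp := encBlocks rest, hold2 := encBlocks us }))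
      (h * (44 * (2 * m * (2 * n)) + 16 * n + 20) + 21 * n + 7) := by
  have hq : ∀ {i j : FReg}, i ≠ j → q i ≠ q j := fun h => q.injective.ne h
  have hlus : (encBlocks us).length ≤ h * (2 * (2 * m * (2 * n)) + 2) := by
    unfold encBlocks
    rw [length_encList, List.map_map]
    have : ∀ x ∈ us.map (fun a => 2 * (encVec a).length + 2), x ≤ 2 * (2 * m * (2 * n)) + 2 := by
      intro x hx; rw [List.mem_map] at hx; obtain ⟨u, hu, rfl⟩ := hx
      have := length_encVec_block (hus u hu) hn; omega
    have hs := List.sum_le_card_nsmul _ _ this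
    rw [List.length_map, hlen, smul_eq_mul] at hs
    exact hs
  let z1 : FSlots := { z with cnt := List.replicate h true }
  let z2 : FSlots := { z with inp := encBlocks rest, cnt := [], hold := pushBlocks us [] }
  let z3 : FSlots := { z with inp := encBlocks rest, cnt := [], hold := [], hold2 := encBlocks us }
  have h1 : Runs (nToUnary (q .CNT) (q .HN)) (base (fSt q T z)) (base (fSt q T z1)) (n * (16 * h + 21) + 5) := by
    refine (runs_nToUnary (q .CNT) (q .HN) (fSt q T z) (by simp [hzc])).of_eq (by simp [z1, hHN]) ?_
    simp only [fSt_HN, hHN, bitsToNat_encodeNat]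
    exact Nat.add_le_add_right (Nat.mul_le_mul_right _ hhn) _
  have h2 : Runs (countLoop (Sum.inr (q .CNT)) (moveBlock q)) (base (fSt q T z1)) (base (fSt q T z2))
      (h * (38 * (2 * m * (2 * n)) + 14) + 1) := by
    have := runs_moveBlocks q (m := m) hn T hW hTT z1 (bs := us) (rest := rest) hus (by simp [z1, hzin]) (by simp [z1, hzt])
      (by simp [z1, hlen])
    rw [hlen] at this
    exact this.of_eq (by simp [z1, z2, hzh]) le_rfl
  have h3 : Runs (pour (Sum.inr (q .HOLD)) (Sum.inr (q .HOLD2))) (base (fSt q T z2)) (base (fSt q T z3))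
      (3 * (h * (2 * (2 * m * (2 * n)) + 2)) + 1) := by
    have hpb : pushBlocks us [] = outRev (us.map encVec) := by
      have := pushBlocks_outRev us []; simpa using this
    refine (runs_opour (a := q .HOLD) (b := q .HOLD2) (hq (by decide)) (fSt q T z2)).of_eq ?_ ?_
    · simp [z2, z3, hpb, hzh2, reverse_outRev, encBlocks]
    · simp only [fSt_HOLD, z2, hpb, ← reverse_encBlocks, List.length_reverse]; omega
  refine (h1.seq (h2.seq h3)).of_eq (by simp only [z3, hzc, hzh]) (le_of_eq ?_)
  ring

/-- Length of the code of a list of valid blocks. [folklore] -/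
theorem length_encBlocks_le {N n m : ℕ} (hn : (encodeNat N).length + 1 ≤ n) {Bs : List (List ℕ)}
    (hBs : ∀ b ∈ Bs, b.length = 2 * m ∧ ∀ a ∈ b, a < N) : (encBlocks Bs).length ≤ Bs.length * (2 * (2 * m * (2 * n)) + 2) := by
  unfold encBlocks
  rw [length_encList, List.map_map]
  have : ∀ x ∈ Bs.map (fun a => 2 * (encVec a).length + 2), x ≤ 2 * (2 * m * (2 * n)) + 2 := by
    intro x hx; rw [List.mem_map] at hx; obtain ⟨u, hu, rfl⟩ := hx
    have := length_encVec_block (hBs u hu) hn; omega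
  have hs := List.sum_le_card_nsmul _ _ this
  rwa [List.length_map, smul_eq_mul] at hs

/-- Members of a `zipWith` come from members. [folklore] -/
theorem exists_mem_of_mem_zipWith {α' β' γ : Type*} {f : α' → β' → γ} :
    ∀ {l : List α'} {l' : List β'} {x : γ}, x ∈ List.zipWith f l l' → ∃ a ∈ l, ∃ b ∈ l', x = f a b
  | [], _, _, h => by simp at h
  | _ :: _, [], _, h => by simp at h
  | a :: l, b :: l', x, h => by
    rw [List.zipWith_cons_cons, List.mem_cons] at h
    rcases h with rfl | h
    · exact ⟨a, by simp, b, by simp, rfl⟩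
    · obtain ⟨a', ha', b', hb', rfl⟩ := exists_mem_of_mem_zipWith h
      exact ⟨a', by simp [ha'], b', by simp [hb'], rfl⟩

/-- Members of a `zipWith` of blocks are valid if the operation preserves validity. [folklore] -/
theorem forall_zipWith_valid {N m : ℕ} {f : List ℕ → List ℕ → List ℕ}
    (hf : ∀ u w, (u.length = 2 * m ∧ ∀ a ∈ u, a < N) → (w.length = 2 * m ∧ ∀ a ∈ w, a < N) → ((f u w).length = 2 * m ∧ ∀ a ∈ f u w, a < N))
    {us ws : List (List ℕ)} (hus : ∀ u ∈ us, u.length = 2 * m ∧ ∀ a ∈ u, a < N) (hws : ∀ w ∈ ws, w.length = 2 * m ∧ ∀ a ∈ w, a < N) :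
    ∀ b ∈ List.zipWith f us ws, b.length = 2 * m ∧ ∀ a ∈ b, a < N := by
  intro b hb
  obtain ⟨u, hu, w, hw, rfl⟩ := exists_mem_of_mem_zipWith hb
  exact hf u w (hus u hu) (hws w hw)

/-- Cost of phase C with a pair operation of cost `cP`, on a segment of half-length `h`. [folklore] -/
def segZipCost (cP n m h : ℕ) : ℕ := h * (cP + 12 * (2 * m * (2 * n)) + 14) + 16 * h * n + 23 * n + 9

/-- **Phase C.** With `HN = encodeNat h`, `HOLD2 = encBlocks us`, `IN = encBlocks (ws ++ rest)` (`|us| = |ws| = h`),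
`E = encodeNat E`, `OACC = outRev (D…)`, `SACC`, `TMP`, `CNT` empty: the zip loop runs, the second halves are
transferred, and `OACC = outRev ((D ++ zipWith (g₁ E) us ws ++ zipWith (g₂ E) us ws)…)`, `E` cleared. [folklore] -/
theorem runs_segZip {body : Com (EReg ⊕ β)} {T : Regs β} {N m : ℕ} {g₁ g₂ : ℕ → List ℕ → List ℕ → List ℕ} {cP : ℕ}
    (hP : PairOp q body T N m g₁ g₂ cP)
    (hg₂ : ∀ E u w, (u.length = 2 * m ∧ ∀ a ∈ u, a < N) → (w.length = 2 * m ∧ ∀ a ∈ w, a < N) →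
      ((g₂ E u w).length = 2 * m ∧ ∀ a ∈ g₂ E u w, a < N))
    {n h E : ℕ} (hn : (encodeNat N).length + 1 ≤ n) (hhn : (encodeNat h).length ≤ n) (hHN : T (q .HN) = encodeNat h)
    (hE : E < 4 * m) (hE1 : 1 ≤ E) (hEn : (encodeNat E).length ≤ n) (z : FSlots) {us ws rest D : List (List ℕ)}
    (hus : ∀ u ∈ us, u.length = 2 * m ∧ ∀ a ∈ u, a < N) (hws : ∀ w ∈ ws, w.length = 2 * m ∧ ∀ a ∈ w, a < N)
    (hlu : us.length = h) (hlw : ws.length = h)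
    (hzin : z.inp = encBlocks (ws ++ rest)) (hzh2 : z.hold2 = encBlocks us) (hze : z.e = encodeNat E)
    (hzl1 : z.l1 = []) (hzl2 : z.l2 = []) (hzd : z.dst = []) (hzx1 : z.x1 = []) (hzx2 : z.x2 = []) (hzt1 : z.t1 = [])
    (hzc : z.cnt = []) (hzt : z.tmp = []) (hzo : z.oacc = outRev (D.map encVec)) (hzs : z.sacc = []) :
    Runs (segZip q body) (base (fSt q T z))
      (base (fSt q T { z with inp := encBlocks rest, hold2 := [], e := [], oacc := outRev ((D ++ List.zipWith (g₁ E) us ws ++ List.zipWith (g₂ E) us ws).map encVec) }))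
      (segZipCost cP n m h) := by
  have hq : ∀ {i j : FReg}, i ≠ j → q i ≠ q j := fun h => q.injective.ne h
  set r₁ := List.zipWith (g₁ E) us ws with hr₁
  set r₂ := List.zipWith (g₂ E) us ws with hr₂
  have hr₂v : ∀ b ∈ r₂, b.length = 2 * m ∧ ∀ a ∈ b, a < N := forall_zipWith_valid (hg₂ E) hus hws
  have hlr₂ : r₂.length = h := by rw [hr₂, List.length_zipWith, hlu, hlw, min_self]
  have hlenc : (encBlocks r₂).length ≤ h * (2 * (2 * m * (2 * n)) + 2) := by
    have := length_encBlocks_le (m := m) hn hr₂v; rwa [hlr₂] at this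
  have ho : pushAll (g₁ E) us ws z.oacc = outRev ((D ++ r₁).map encVec) := by rw [hzo, pushAll_outRev _ _ _ _ (hlu.trans hlw.symm)]
  have hsa : pushAll (g₂ E) us ws z.sacc = outRev (r₂.map encVec) := by
    have := pushAll_outRev (g₂ E) us ws [] (hlu.trans hlw.symm)
    rw [List.map_nil, outRev_nil, List.nil_append] at this
    rw [hzs]; exact this
  let z1 : FSlots := { z with cnt := List.replicate h true }
  let z2 : FSlots := { z with inp := encBlocks rest, hold2 := [], cnt := [], oacc := outRev ((D ++ r₁).map encVec), sacc := outRev (r₂.map encVec) }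
  let z3 : FSlots := { z with inp := encBlocks rest, hold2 := [], cnt := [], oacc := outRev ((D ++ r₁).map encVec), sacc := [], tmp := encBlocks r₂ }
  let z4 : FSlots := { z with inp := encBlocks rest, hold2 := [], cnt := [], oacc := outRev ((D ++ r₁ ++ r₂).map encVec), sacc := [], tmp := [] }
  let z5 : FSlots := { z with inp := encBlocks rest, hold2 := [], cnt := [], oacc := outRev ((D ++ r₁ ++ r₂).map encVec), sacc := [], tmp := [], e := [] }
  have h1 : Runs (nToUnary (q .CNT) (q .HN)) (base (fSt q T z)) (base (fSt q T z1)) (n * (16 * h + 21) + 5) := by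
    refine (runs_nToUnary (q .CNT) (q .HN) (fSt q T z) (by simp [hzc])).of_eq (by simp [z1, hHN]) ?_
    simp only [fSt_HN, hHN, bitsToNat_encodeNat]
    exact Nat.add_le_add_right (Nat.mul_le_mul_right _ hhn) _
  have h2 : Runs (countLoop (Sum.inr (q .CNT)) body) (base (fSt q T z1)) (base (fSt q T z2)) (h * (cP + 2) + 1) := by
    have := runs_pairLoop q hP z1 hE hE1 (rest := rest) hus hws (hlu.trans hlw.symm) (by simp [z1, hzin]) (by simp [z1, hzh2]) (by simp [z1, hze])
      (by simp [z1, hzl1]) (by simp [z1, hzl2]) (by simp [z1, hzd]) (by simp [z1, hzx1]) (by simp [z1, hzx2]) (by simp [z1, hzt1])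
      (by simp [z1, hlu])
    rw [hlu] at this
    exact this.of_eq (by simp [z1, z2, ho, hsa]) le_rfl
  have h3 : Runs (pour (Sum.inr (q .SACC)) (Sum.inr (q .TMP))) (base (fSt q T z2)) (base (fSt q T z3))
      (3 * (h * (2 * (2 * m * (2 * n)) + 2)) + 1) := by
    refine (runs_opour (a := q .SACC) (b := q .TMP) (hq (by decide)) (fSt q T z2)).of_eq ?_ ?_
    · simp [z2, z3, hzt, reverse_outRev, encBlocks]
    · simp only [fSt_SACC, z2, ← reverse_encBlocks, List.length_reverse]; omega
  have h4 : Runs (pour (Sum.inr (q .TMP)) (Sum.inr (q .OACC))) (base (fSt q T z3)) (base (fSt q T z4))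
      (3 * (h * (2 * (2 * m * (2 * n)) + 2)) + 1) := by
    refine (runs_opour (a := q .TMP) (b := q .OACC) (hq (by decide)) (fSt q T z3)).of_eq ?_ ?_
    · simp [z3, z4, reverse_encBlocks, outRev_append_list, List.map_append]
    · simp only [fSt_TMP, z3]; omega
  have h5 : Runs (clear (vr (rVF q) .E)) (base (fSt q T z4)) (base (fSt q T z5)) (2 * n + 1) := by
    refine (runs_clear (vr (rVF q) .E) (base (fSt q T z4))).of_eq (by simp [z4, z5]) ?_
    change 2 * (fSt q T z4 (rVF q .E)).length + 1 ≤ 2 * n + 1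
    have : (fSt q T z4 (rVF q .E)).length ≤ n := by simp [z4, hze, hEn]
    omega
  refine (h1.seq (h2.seq (h3.seq (h4.seq h5)))).of_eq (by simp only [z5, hr₁, hr₂, List.append_assoc, hzc, hzt, hzs]) ?_
  unfold segZipCost
  nlinarith [Nat.zero_le (h * (2 * m * (2 * n))), Nat.zero_le (h * n)]

/-- Cost of a segment of half-length `h` with a pair operation of cost `cP`. [folklore] -/
def segCost (cP n m h : ℕ) : ℕ := h * (cP + 56 * (2 * m * (2 * n)) + 48 * n + 34) + 44 * n + 200 * (n + 1) ^ 3 + 16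

/-- **A segment.** With the next twiddle `F = 2E` at the head of `TW`, the segment's `2h`
blocks `us ++ ws` at the head of `IN`, `OACC = outRev (D…)`, `TWACC = outRev (G…)` and the
working registers clean: `TW` advances, `IN := encBlocks rest`,
`OACC := outRev ((D ++ zipWith (g₁ E) us ws ++ zipWith (g₂ E) us ws)…)`, `TWACC` gains `E`,
`E + 2m`, all else restored. [folklore] -/
theorem runs_segBody {body : Com (EReg ⊕ β)} {T : Regs β} {N m : ℕ} {g₁ g₂ : ℕ → List ℕ → List ℕ → List ℕ} {cP : ℕ}
    (hP : PairOp q body T N m g₁ g₂ cP)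
    (hg₂ : ∀ E u w, (u.length = 2 * m ∧ ∀ a ∈ u, a < N) → (w.length = 2 * m ∧ ∀ a ∈ w, a < N) →
      ((g₂ E u w).length = 2 * m ∧ ∀ a ∈ g₂ E u w, a < N))
    {n h E : ℕ} (hn : (encodeNat N).length + 1 ≤ n) (hm4n : (encodeNat (4 * m)).length + 1 ≤ n)
    (hhn : (encodeNat h).length ≤ n) (hHN : T (q .HN) = encodeNat h) (hM2 : T (q .M2) = encodeNat (2 * m))
    (hW : T (q (.n (.v .W))) = []) (hTT : T (q (.n (.v .TT))) = []) (hE : E < 4 * m) (hE1 : 1 ≤ E)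
    (z : FSlots) {Fs G : List ℕ} {us ws rest D : List (List ℕ)}
    (hus : ∀ u ∈ us, u.length = 2 * m ∧ ∀ a ∈ u, a < N) (hws : ∀ w ∈ ws, w.length = 2 * m ∧ ∀ a ∈ w, a < N)
    (hlu : us.length = h) (hlw : ws.length = h)
    (hztw : z.tw = encVec (2 * E :: Fs)) (hzin : z.inp = encBlocks (us ++ ws ++ rest)) (hze : z.e = []) (hzh : z.hold = [])
    (hzh2 : z.hold2 = []) (hzl1 : z.l1 = []) (hzl2 : z.l2 = []) (hzd : z.dst = []) (hzx1 : z.x1 = []) (hzx2 : z.x2 = [])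
    (hzt1 : z.t1 = []) (hzc : z.cnt = []) (hzt : z.tmp = []) (hzo : z.oacc = outRev (D.map encVec)) (hzs : z.sacc = [])
    (hztwacc : z.twacc = outRev (G.map encodeNat)) :
    Runs (segBody q body) (base (fSt q T z))
      (base (fSt q T { z with tw := encVec Fs, inp := encBlocks rest, oacc := outRev ((D ++ List.zipWith (g₁ E) us ws ++ List.zipWith (g₂ E) us ws).map encVec), twacc := outRev ((G ++ [E, E + 2 * m]).map encodeNat) }))
      (segCost cP n m h) := by
  have hEn : (encodeNat E).length ≤ n := (Brick.length_encodeNat_mono hE.le).trans (by omega)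
  let z1 : FSlots := { z with tw := encVec Fs, e := encodeNat E, twacc := outRev ((G ++ [E, E + 2 * m]).map encodeNat) }
  let z2 : FSlots := { z with tw := encVec Fs, e := encodeNat E, twacc := outRev ((G ++ [E, E + 2 * m]).map encodeNat), inp := encBlocks (ws ++ rest), hold2 := encBlocks us }
  have h1 : Runs (segTwiddle q) (base (fSt q T z)) (base (fSt q T z1)) (200 * (n + 1) ^ 3) :=
    (runs_segTwiddle q hm4n hE hE1 T hM2 hW hTT z hztw hze hzt1 hztwacc).of_eq rfl le_rfl
  have h2 : Runs (segSplit q) (base (fSt q T z1)) (base (fSt q T z2)) (h * (44 * (2 * m * (2 * n)) + 16 * n + 20) + 21 * n + 7) :=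
    (runs_segSplit q (m := m) hn hhn T hHN hW hTT z1 (us := us) (rest := ws ++ rest) hus hlu (by simp [z1, hzin, List.append_assoc])
      (by simp [z1, hzt]) (by simp [z1, hzc]) (by simp [z1, hzh]) (by simp [z1, hzh2])).of_eq rfl le_rfl
  have h3 := runs_segZip q hP hg₂ hn hhn hHN hE hE1 hEn z2 (us := us) (ws := ws) (rest := rest) (D := D) hus hws hlu hlw
    rfl rfl rfl (by simp [z2, hzl1]) (by simp [z2, hzl2]) (by simp [z2, hzd]) (by simp [z2, hzx1]) (by simp [z2, hzx2])
    (by simp [z2, hzt1]) (by simp [z2, hzc]) (by simp [z2, hzt]) (by simp [z2, hzo]) (by simp [z2, hzs])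
  refine (h1.seq (h2.seq h3)).of_eq (by simp only [z2, hze, hzh2]) ?_
  unfold segZipCost segCost
  nlinarith [Nat.zero_le (h * (2 * m * (2 * n))), Nat.zero_le (h * n)]

/-! ### A level: the segment loop over the twiddle list -/

/-- The list-level effect of a level pass: segment by segment (twiddle `F`, `2h` blocks), the
results of `g₁ (F/2)` on the two halves, then those of `g₂ (F/2)`. [folklore] -/
def _root_.Literature.Computability.Complexity.levelOut (g₁ g₂ : ℕ → List ℕ → List ℕ → List ℕ) (h : ℕ) :
    List ℕ → List (List ℕ) → List (List ℕ)
  | [], _ => []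
  | F :: Fs, Bs => (List.zipWith (g₁ (F / 2)) (Bs.take h) ((Bs.drop h).take h) ++
      List.zipWith (g₂ (F / 2)) (Bs.take h) ((Bs.drop h).take h)) ++ levelOut g₁ g₂ h Fs (Bs.drop (2 * h))

/-- The children twiddle list of a level: `F ↦ F/2, F/2 + 2m`. [folklore] -/
def _root_.Literature.Computability.Complexity.childTw (m : ℕ) (Fs : List ℕ) : List ℕ :=
  Fs.flatMap fun F => [F / 2, F / 2 + 2 * m]

/-- `levelOut` processes a concatenation of twiddle lists in order. [folklore] -/
theorem _root_.Literature.Computability.Complexity.levelOut_append (g₁ g₂ : ℕ → List ℕ → List ℕ → List ℕ) (h : ℕ) :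
    ∀ (Fs₁ Fs₂ : List ℕ) (Bs : List (List ℕ)),
      levelOut g₁ g₂ h (Fs₁ ++ Fs₂) Bs = levelOut g₁ g₂ h Fs₁ Bs ++ levelOut g₁ g₂ h Fs₂ (Bs.drop (2 * h * Fs₁.length))
  | [], Fs₂, Bs => by simp [levelOut]
  | F :: Fs₁, Fs₂, Bs => by
    rw [List.cons_append, levelOut, levelOut_append g₁ g₂ h Fs₁ Fs₂, levelOut, List.drop_drop,
      List.length_cons, show 2 * h + 2 * h * Fs₁.length = 2 * h * (Fs₁.length + 1) by ring]
    simp only [List.append_assoc]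

/-- `childTw` of a concatenation. [folklore] -/
theorem _root_.Literature.Computability.Complexity.childTw_append (m : ℕ) (Fs₁ Fs₂ : List ℕ) :
    childTw m (Fs₁ ++ Fs₂) = childTw m Fs₁ ++ childTw m Fs₂ := by
  simp [childTw, List.flatMap_append]

/-- The level pass: the segment loop over `TW`, then the outputs are poured forward onto `OUT`
and `TWOUT`. [folklore] -/
def levelPass (pairC : Com (EReg ⊕ β)) : Com (EReg ⊕ β) :=
  streamLoop (Sum.inr (q .TW)) (vr (rVF q) .W) (segBody q pairC) ;;
  (pour (Sum.inr (q .OACC)) (Sum.inr (q .OUT)) ;; pour (Sum.inr (q .TWACC)) (Sum.inr (q .TWOUT)))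

/-- Cost of a level pass with `t` segments of half-length `h`. [folklore] -/
def levelCost (cP n m h t : ℕ) : ℕ := t * (segCost cP n m h + 12 * (h * (2 * m * (2 * n))) + 12 * h + 12 * n + 18) + 6

/-- `childTw` has two entries per twiddle. [folklore] -/
theorem _root_.Literature.Computability.Complexity.length_childTw (m : ℕ) (Fs : List ℕ) : (childTw m Fs).length = 2 * Fs.length := by
  induction Fs with
  | nil => rfl
  | cons F Fs ih => simp only [childTw, List.flatMap_cons, List.length_append, List.length_cons, List.length_nil] at ih ⊢; omega

/-- `levelOut` has as many blocks as the input segments cover. [folklore] -/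
theorem _root_.Literature.Computability.Complexity.length_levelOut (g₁ g₂ : ℕ → List ℕ → List ℕ → List ℕ) (h : ℕ) :
    ∀ (Fs : List ℕ) (Bs : List (List ℕ)), Bs.length = 2 * h * Fs.length → (levelOut g₁ g₂ h Fs Bs).length = 2 * h * Fs.length
  | [], _, _ => rfl
  | F :: Fs, Bs, hBs => by
    rw [List.length_cons] at hBs
    have := length_levelOut g₁ g₂ h Fs (Bs.drop (2 * h)) (by rw [List.length_drop, hBs]; ring_nf; omega)
    rw [levelOut, List.length_append, List.length_append, List.length_zipWith, List.length_zipWith, List.length_take,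
      List.length_take, List.length_drop, this, List.length_cons]
    have h1 : h ≤ Bs.length := by rw [hBs]; nlinarith
    have h2 : h ≤ Bs.length - h := by rw [hBs]; ring_nf; omega
    rw [min_eq_left h1, min_eq_left h2, min_self]; ring

/-- Blocks of `levelOut` are valid when `g₁`, `g₂` preserve validity. [folklore] -/
theorem _root_.Literature.Computability.Complexity.levelOut_valid {N m : ℕ} {g₁ g₂ : ℕ → List ℕ → List ℕ → List ℕ}
    (hg₁ : ∀ E u w, (u.length = 2 * m ∧ ∀ a ∈ u, a < N) → (w.length = 2 * m ∧ ∀ a ∈ w, a < N) →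
      ((g₁ E u w).length = 2 * m ∧ ∀ a ∈ g₁ E u w, a < N))
    (hg₂ : ∀ E u w, (u.length = 2 * m ∧ ∀ a ∈ u, a < N) → (w.length = 2 * m ∧ ∀ a ∈ w, a < N) →
      ((g₂ E u w).length = 2 * m ∧ ∀ a ∈ g₂ E u w, a < N)) (h : ℕ) :
    ∀ (Fs : List ℕ) (Bs : List (List ℕ)), (∀ b ∈ Bs, b.length = 2 * m ∧ ∀ a ∈ b, a < N) →
      ∀ b ∈ levelOut g₁ g₂ h Fs Bs, b.length = 2 * m ∧ ∀ a ∈ b, a < N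
  | [], _, _, b, hb => by simp [levelOut] at hb
  | F :: Fs, Bs, hBs, b, hb => by
    rw [levelOut, List.mem_append, List.mem_append] at hb
    have htk : ∀ b ∈ Bs.take h, b.length = 2 * m ∧ ∀ a ∈ b, a < N := fun b hb => hBs b (List.mem_of_mem_take hb)
    have hdt : ∀ b ∈ (Bs.drop h).take h, b.length = 2 * m ∧ ∀ a ∈ b, a < N :=
      fun b hb => hBs b (List.mem_of_mem_drop (List.mem_of_mem_take hb))
    rcases hb with (hb | hb) | hb
    · exact Com.forall_zipWith_valid (hg₁ (F / 2)) htk hdt b hb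
    · exact Com.forall_zipWith_valid (hg₂ (F / 2)) htk hdt b hb
    · exact levelOut_valid hg₁ hg₂ h Fs (Bs.drop (2 * h)) (fun b hb => hBs b (List.mem_of_mem_drop hb)) b hb

omit [DecidableEq β] in
/-- Reads from the level invariant. [folklore] -/
theorem lvlInv_reads {N m : ℕ} {cw : List Bool} {T : Regs β} (hI : LvlInv q N m cw T) :
    T (q .M2) = encodeNat (2 * m) ∧ T (q (.n (.v .W))) = [] ∧ T (q (.n (.v .TT))) = [] :=
  ⟨hI.2.2.2.1, hI.2.2.2.2.2.2.2.2.2.2.1, hI.2.2.2.2.2.2.2.2.2.2.2.1⟩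

/-- **The level pass.** With the twiddles `Fs` (each `F = 2E`, `1 ≤ E < 4m`) in `TW`, the
`2h·|Fs|` valid blocks `Bs` in `IN`, `h` in `HN` and the working registers clean, the pass
consumes `TW` and `IN` and puts `encBlocks (levelOut g₁ g₂ h Fs Bs)` on top of `OUT` and
`encVec (childTw m Fs)` on top of `TWOUT`, within `levelCost cP n m h |Fs|`. [folklore] -/
theorem runs_levelPass {body : Com (EReg ⊕ β)} {T : Regs β} {N m : ℕ} {cw : List Bool} {g₁ g₂ : ℕ → List ℕ → List ℕ → List ℕ}
    {cP : ℕ} (hI : LvlInv q N m cw T) (hP : PairOp q body T N m g₁ g₂ cP)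
    (hg₁ : ∀ E u w, (u.length = 2 * m ∧ ∀ a ∈ u, a < N) → (w.length = 2 * m ∧ ∀ a ∈ w, a < N) →
      ((g₁ E u w).length = 2 * m ∧ ∀ a ∈ g₁ E u w, a < N))
    (hg₂ : ∀ E u w, (u.length = 2 * m ∧ ∀ a ∈ u, a < N) → (w.length = 2 * m ∧ ∀ a ∈ w, a < N) →
      ((g₂ E u w).length = 2 * m ∧ ∀ a ∈ g₂ E u w, a < N))
    {n h : ℕ} (hn : (encodeNat N).length + 1 ≤ n) (hm4n : (encodeNat (4 * m)).length + 1 ≤ n)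
    (hhn : (encodeNat h).length ≤ n) (hHN : T (q .HN) = encodeNat h)
    {Fs : List ℕ} {Bs : List (List ℕ)}
    (hFs : ∀ F ∈ Fs, F = 2 * (F / 2) ∧ 1 ≤ F / 2 ∧ F / 2 < 4 * m)
    (hBs : ∀ b ∈ Bs, b.length = 2 * m ∧ ∀ a ∈ b, a < N) (hlen : Bs.length = 2 * h * Fs.length)
    (hold tmp t1 cnt x1 x2 sacc e l1 l2 dst : List Bool)
    (hzh : hold = []) (hzt : tmp = []) (hzt1 : t1 = []) (hzc : cnt = []) (hzx1 : x1 = []) (hzx2 : x2 = [])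
    (hzs : sacc = []) (hze : e = []) (hzl1 : l1 = []) (hzl2 : l2 = []) (hzd : dst = []) :
    Runs (levelPass q body) (base (fSt q T ⟨encBlocks Bs, hold, [], tmp, encVec Fs, [], t1, cnt, x1, x2, [], sacc, e, l1, l2, dst⟩))
      (base (Function.update (Function.update (fSt q T ⟨[], hold, [], tmp, [], [], t1, cnt, x1, x2, [], sacc, e, l1, l2, dst⟩) (q .OUT)
        (encBlocks (levelOut g₁ g₂ h Fs Bs) ++ T (q .OUT))) (q .TWOUT) (encVec (childTw m Fs) ++ T (q .TWOUT))))
      (levelCost cP n m h Fs.length) := by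
  have hq : ∀ {i j : FReg}, i ≠ j → q i ≠ q j := fun h => q.injective.ne h
  obtain ⟨hM2, hW, hTT⟩ := lvlInv_reads q hI
  subst hzh hzt hzt1 hzc hzx1 hzx2 hzs hze hzl1 hzl2 hzd
  -- state after the segments of `Fs₁`, `l` still to do
  let zOf : List ℕ → List ℕ → FSlots := fun Fs₁ l =>
    ⟨encBlocks (Bs.drop (2 * h * Fs₁.length)), [], [], [], encVec l, outRev ((childTw m Fs₁).map encodeNat), [], [], [], [],
      outRev ((levelOut g₁ g₂ h Fs₁ Bs).map encVec), [], [], [], [], []⟩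
  have hloop := runs_streamLoop (L := Sum.inr (q .TW)) (w := vr (rVF q) .W) (by simp [hq]) (body := segBody q body)
    encVec rfl (fun a l => encVec_cons_ne_nil _ _)
    (fun l R => ∃ Fs₁, Fs₁ ++ l = Fs ∧ R = base (fSt q T (zOf Fs₁ l))) (fun _ => segCost cP n m h)
    (by
      rintro F l R ⟨Fs₁, hFl, rfl⟩ - -
      have hFmem : F ∈ Fs := by rw [← hFl]; simp
      obtain ⟨hF2, hE1, hE⟩ := hFs F hFmem
      set k := 2 * h * Fs₁.length with hk
      have hkle : k + 2 * h ≤ Bs.length := by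
        rw [hlen, ← hFl, List.length_append, List.length_cons, hk]; nlinarith
      set us := (Bs.drop k).take h with husd
      set ws := ((Bs.drop k).drop h).take h with hwsd
      set rest := (Bs.drop k).drop (2 * h) with hrestd
      have hsplit : Bs.drop k = us ++ ws ++ rest := by
        rw [husd, hwsd, hrestd, List.append_assoc, show 2 * h = h + h by ring, ← List.drop_drop, List.take_append_drop,
          List.take_append_drop]
      have hlu : us.length = h := by rw [husd, List.length_take, List.length_drop]; omega
      have hlw : ws.length = h := by rw [hwsd, List.length_take, List.length_drop, List.length_drop]; omega
      have hus : ∀ u ∈ us, u.length = 2 * m ∧ ∀ a ∈ u, a < N := fun u hu => hBs u (List.mem_of_mem_drop (List.mem_of_mem_take hu))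
      have hws : ∀ w ∈ ws, w.length = 2 * m ∧ ∀ a ∈ w, a < N :=
        fun w hw => hBs w (List.mem_of_mem_drop (List.mem_of_mem_drop (List.mem_of_mem_take hw)))
      have hb := runs_segBody q hP hg₂ hn hm4n hhn hHN hM2 hW hTT hE hE1 (zOf Fs₁ (F :: l)) (Fs := l)
        (G := childTw m Fs₁) (us := us) (ws := ws) (rest := rest) (D := levelOut g₁ g₂ h Fs₁ Bs) hus hws hlu hlw
        (hF2 ▸ (rfl : (zOf Fs₁ (F :: l)).tw = encVec (F :: l)))
        (hsplit ▸ (rfl : (zOf Fs₁ (F :: l)).inp = encBlocks (Bs.drop k)))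
        rfl rfl rfl rfl rfl rfl rfl rfl rfl rfl rfl rfl rfl rfl
      have heq : base (fSt q T { zOf Fs₁ (F :: l) with tw := encVec l, inp := encBlocks rest, oacc := outRev ((levelOut g₁ g₂ h Fs₁ Bs ++ List.zipWith (g₁ (F / 2)) us ws ++ List.zipWith (g₂ (F / 2)) us ws).map encVec), twacc := outRev ((childTw m Fs₁ ++ [F / 2, F / 2 + 2 * m]).map encodeNat) }) = base (fSt q T (zOf (Fs₁ ++ [F]) l)) := by
        simp only [zOf, levelOut_append, levelOut, childTw_append, List.length_append, List.length_singleton, List.append_nil,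
          List.append_assoc]
        congr 4
        rw [hrestd, List.drop_drop, hk, show 2 * h * Fs₁.length + 2 * h = 2 * h * (Fs₁.length + 1) by ring]
      refine ⟨_, hb.of_eq heq le_rfl, by simp [zOf], ?_, Fs₁ ++ [F], by rw [List.append_assoc]; exact hFl, rfl⟩
      exact (fSt_v q T _ (by decide) (by decide) (by decide) (by decide)).trans hW)
    Fs (base (fSt q T (zOf [] Fs))) ⟨[], rfl, rfl⟩ (by simp [zOf])
    ((fSt_v q T _ (by decide) (by decide) (by decide) (by decide)).trans hW)
  obtain ⟨R', hl, -, -, Fs₁, hdone, rfl⟩ := hloop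
  rw [List.append_nil] at hdone
  subst hdone
  have hstart : zOf [] Fs₁ = ⟨encBlocks Bs, [], [], [], encVec Fs₁, [], [], [], [], [], [], [], [], [], [], []⟩ := by
    simp only [zOf, levelOut, childTw, List.length_nil, mul_zero, List.drop_zero, List.map_nil, outRev_nil, List.flatMap_nil]
  rw [hstart] at hl
  -- after the loop
  set out := levelOut g₁ g₂ h Fs₁ Bs with hout
  set tw' := childTw m Fs₁ with htw'
  have hdropall : Bs.drop (2 * h * Fs₁.length) = [] := List.drop_of_length_le (by rw [hlen])
  have hend : zOf Fs₁ [] = ⟨[], [], [], [], [], outRev (tw'.map encodeNat), [], [], [], [], outRev (out.map encVec), [], [], [], [], []⟩ := by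
    simp only [zOf, hdropall, encBlocks_nil, encVec_nil, htw', hout]
  rw [hend] at hl
  -- lengths for the cost of the pours
  have hov : ∀ b ∈ out, b.length = 2 * m ∧ ∀ a ∈ b, a < N := levelOut_valid hg₁ hg₂ h Fs₁ Bs hBs
  have hlo : (outRev (out.map encVec)).length ≤ 2 * h * Fs₁.length * (2 * (2 * m * (2 * n)) + 2) := by
    rw [← reverse_encBlocks, List.length_reverse]
    have := length_encBlocks_le (m := m) hn hov; rwa [hout, length_levelOut g₁ g₂ h Fs₁ Bs hlen] at this
  have hltw : (outRev (tw'.map encodeNat)).length ≤ 2 * Fs₁.length * (2 * n + 2) := by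
    rw [← List.length_reverse, reverse_outRev_map]
    rcases Nat.eq_zero_or_pos m with rfl | hm
    · have : Fs₁ = [] := by
        rcases Fs₁ with _ | ⟨F, l⟩
        · rfl
        · have := (hFs F (by simp)).2.2; omega
      subst this; simp [htw', childTw]
    · have hct : ∀ x ∈ tw', x < 4 * m + 4 * m := by
        intro x hx
        simp only [htw', childTw, List.mem_flatMap, List.mem_cons, List.not_mem_nil, or_false] at hx
        obtain ⟨F, hF, hx⟩ := hx
        have := (hFs F hF).2.2
        rcases hx with rfl | rfl <;> omega
      have h8 : (encodeNat (4 * m + 4 * m)).length + 1 ≤ n + 1 := by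
        rw [show 4 * m + 4 * m = 2 * (4 * m) by ring, encodeNat_two_mul _ (by omega), List.length_cons]; omega
      have := length_encVec_le_of_lt hct h8
      have hl2 : tw'.length = 2 * Fs₁.length := by rw [htw', length_childTw]
      rw [hl2] at this
      exact this.trans (le_of_eq (by ring))
  -- the two pours, explicitly
  set B0 : Regs β := fSt q T ⟨[], [], [], [], [], [], [], [], [], [], [], [], [], [], [], []⟩ with hB0
  have hS1 : fSt q T ⟨[], [], [], [], [], outRev (tw'.map encodeNat), [], [], [], [], outRev (out.map encVec), [], [], [], [], []⟩ =
      Function.update (Function.update B0 (q .OACC) (outRev (out.map encVec))) (q .TWACC) (outRev (tw'.map encodeNat)) := by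
    rw [hB0, update_fSt_OACC, update_fSt_TWACC]
  rw [hS1] at hl
  have rOUT : B0 (q .OUT) = T (q .OUT) := fSt_OUT q T _
  have rTWOUT : B0 (q .TWOUT) = T (q .TWOUT) := fSt_TWOUT q T _
  have rOACC : B0 (q .OACC) = [] := fSt_OACC q T _
  have rTWACC : B0 (q .TWACC) = [] := fSt_TWACC q T _
  have hp1 := runs_opour (a := q .OACC) (b := q .OUT) (hq (by decide))
    (Function.update (Function.update B0 (q .OACC) (outRev (out.map encVec))) (q .TWACC) (outRev (tw'.map encodeNat)))
  have e1 : Function.update (Function.update (Function.update (Function.update B0 (q .OACC) (outRev (out.map encVec))) (q .TWACC)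
      (outRev (tw'.map encodeNat))) (q .OACC) []) (q .OUT)
      ((Function.update (Function.update B0 (q .OACC) (outRev (out.map encVec))) (q .TWACC) (outRev (tw'.map encodeNat)) (q .OACC)).reverse ++
        Function.update (Function.update B0 (q .OACC) (outRev (out.map encVec))) (q .TWACC) (outRev (tw'.map encodeNat)) (q .OUT)) =
      Function.update (Function.update B0 (q .TWACC) (outRev (tw'.map encodeNat))) (q .OUT) (encBlocks out ++ T (q .OUT)) := by
    rw [Function.update_of_ne (hq (by decide)), Function.update_self, Function.update_of_ne (hq (by decide)),
      Function.update_of_ne (hq (by decide)), rOUT, reverse_outRev]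
    rw [show encList (out.map encVec) = encBlocks out from rfl]
    congr 1
    funext k
    by_cases h1 : k = q .OACC
    · subst h1; simp [hq, rOACC]
    · by_cases h2 : k = q .TWACC
      · subst h2; simp [hq]
      · simp [h1, h2]
  rw [e1] at hp1
  have hp2 := runs_opour (a := q .TWACC) (b := q .TWOUT) (hq (by decide))
    (Function.update (Function.update B0 (q .TWACC) (outRev (tw'.map encodeNat))) (q .OUT) (encBlocks out ++ T (q .OUT)))
  have e2 : Function.update (Function.update (Function.update (Function.update B0 (q .TWACC) (outRev (tw'.map encodeNat))) (q .OUT)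
      (encBlocks out ++ T (q .OUT))) (q .TWACC) []) (q .TWOUT)
      ((Function.update (Function.update B0 (q .TWACC) (outRev (tw'.map encodeNat))) (q .OUT) (encBlocks out ++ T (q .OUT)) (q .TWACC)).reverse ++
        Function.update (Function.update B0 (q .TWACC) (outRev (tw'.map encodeNat))) (q .OUT) (encBlocks out ++ T (q .OUT)) (q .TWOUT)) =
      Function.update (Function.update B0 (q .OUT) (encBlocks out ++ T (q .OUT))) (q .TWOUT) (encVec tw' ++ T (q .TWOUT)) := by
    rw [Function.update_of_ne (hq (by decide)), Function.update_self, Function.update_of_ne (hq (by decide)),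
      Function.update_of_ne (hq (by decide)), rTWOUT, reverse_outRev_map]
    congr 1
    funext k
    by_cases h1 : k = q .TWACC
    · subst h1; simp [hq, rTWACC]
    · by_cases h2 : k = q .OUT
      · subst h2; simp [hq]
      · simp [h1, h2]
  rw [e2] at hp2
  refine (hl.seq (hp1.seq hp2)).of_eq (by rw [hB0]) ?_
  -- cost
  simp only [List.map_const', List.sum_replicate, smul_eq_mul]
  rw [Function.update_of_ne (hq (by decide)), Function.update_self, Function.update_of_ne (hq (by decide)), Function.update_self]
  unfold levelCost
  nlinarith [hlo, hltw, Nat.zero_le (h * (2 * m * (2 * n))), Nat.zero_le (Fs₁.length * n), Nat.zero_le (Fs₁.length * h)]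

end Com

end Literature.Computability.Complexity
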